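import Mathlib
import Literature.MathematicalPhysics.QuantumFieldTheory.Balaban1983to89.MatrixNorms

/-!
# B5, Proposition 1.1 / (1.89): the fiber matrices of `G = Δ_a⁻¹` are bounded, together with
two derivative weights — a kernel version of "we can easily prove that this expression defines
a bounded operator"

Source under audit (cell `pub-balaban`, node T02.1, SHARPEN pass 2; value = kernel-checked
bookkeeping of a located unprinted step, NOT summit progress):
T. Bałaban, *Propagators and renormalization transformations for lattice gauge theories. I*,
Commun. Math. Phys. **95** (1984) 17–40 (`Balaban1984PropagatorsI`, "B5"). Page numbers are
journal pages; quotations are read off the rendered PDF (cell folder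
`b2b-balaban-ref1/pages/1984-cmp95-propagators-rt-I/`, PDF page = journal page − 16).

## What the paper prints (verbatim)

* p. 31, (1.83)–(1.84) (the momentum representation of `G`; `~` = Fourier transform, the sum
  over `l′, ν` is the operator, `φ_μ⁻¹ = 1/φ_μ`):
  "Ã_μ(p′+l) = (GJ)~_μ(p′+l) = 1/Δ(p′+l) · J̃_μ(p′+l)
   − a · conj[u(p′+l)v_μ(p′+l)]/Δ(p′+l) · φ_μ⁻¹(p′) Σ_{l′} u(p′+l′)v_μ(p′+l′)/Δ(p′+l′) · J̃_μ(p′+l′)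
   + [ ∂_μ(p′+l) conj[u(p′+l)]/Δ²(p′+l) · (Σ_{l″} |u(p′+l″)|²/Δ²(p′+l″))⁻¹
       − a · conj[u(p′+l)v_μ(p′+l)]/Δ(p′+l) · φ_μ⁻¹(p′) ∂_{1,μ}(p′) ]
     · a⁻¹ (Σ_λ |∂_{1,λ}(p′)|²/φ_λ(p′))⁻¹
     · Σ_{l′,ν} [ (Σ_{l″} |u(p′+l″)|²/Δ²(p′+l″))⁻¹ u(p′+l′) conj[∂_ν(p′+l′)]/Δ²(p′+l′)
       − a · conj[∂_{1,ν}(p′)] φ_ν⁻¹(p′) u(p′+l′)v_ν(p′+l′)/Δ(p′+l′) ] J̃_ν(p′+l′),      (1.83)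
   for p′ ≠ 0, Ã_μ(l) = 1/Δ(l) · J̃_μ(l), Ã_μ(0) = a⁻¹ J̃_μ(0), where
   φ_μ(p′) = 1 + a Σ_{l″} |u(p′+l″)|² |v_μ(p′+l″)|² / Δ(p′+l″)   for p′ ≠ 0.      (1.84)"
* p. 32: "… the function Δ₀(p′)φ_μ(p′) = Δ₀(p′) + a Σ_{l″} |u(p′+l″)|²|v_μ(p′+l″)|²Δ₀(p′)/Δ(p′+l″)
  (1.85) has a limit as p′ → 0, lim_{p′→0} Δ₀(p′)φ_μ(p′) = a, and it is bounded from below and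
  above by positve constants independent of k and depending on d and a only. From this it
  follows that the function Σ_λ |∂_{1,λ}(p′)|²/(Δ₀²(p′)φ_λ(p′)) (1.86) has the same property,
  hence also its inverse."
* p. 32, after (1.87): "Owing to the cancellation of the terms with l′ = l, the above expression
  can be extended by continuity to p′ = 0. Using all the properties of the functions appearing
  above, e.g. the inequality (1.36), we can easily prove that this expression defines a bounded
  operator on L²(T_η). It is bounded also when differentiated two times at most."
* pp. 32–33, after (1.88): "Again taking into account the cancellation of the terms with l″ = l
  the above expression is well defined by continuity for p′ = 0, and we even get an additional
  factor Δ₀(p′). Because there are two expressions in square brackets in the considered term,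
  we get the additional factor Δ₀²(p′). This factor multiplying the function between the square
  bracket expressions gives an inverse of the expression (1.86) which is also well defined.
  Thus the third term is well defined by continuity at p′ = 0 and defines a bounded operator
  together with its derivatives up to the second order. It can be easily calculated that the
  values at p′ = 0 agree with the second and third equalities in (1.83). We may conclude the
  above considerations in the following
  Proposition 1.1. The operator G is a symmetric operator on L²(T_η) and
  ‖GJ‖, ‖∇GJ‖, ‖G∇*J‖, ‖∇G∇*J‖, ‖∇∇GJ‖, ‖G∇*∇*J‖ ≤ γ₀⁻¹‖J‖,      (1.89)
  with a positive constant γ₀ independent of k, T_η, and depending on d only (if we put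
  a = 1)." (tree: `B5.Prop11Printed`.)

The paper prints NO proof of (1.89) beyond the sentences quoted ("we can easily prove …",
"… defines a bounded operator together with its derivatives up to the second order") and
prints no value of `γ₀`.  This module is a kernel-checked version of that unprinted step at
the level of the FIBER MATRICES of (1.83).

## What is certified here (kernel; 0 sorry; no axioms beyond Mathlib's)

Fix a fiber `p′ ≠ 0`.  The structure `Fiber Λ d` abstracts the data of (1.83) at that fiber
(`Λ` = the finite set of offsets `l`; `o` = the offset `l = 0`; `u l = u(p′+l)`,
`v μ l = v_μ(p′+l)`, `e μ l = ∂_μ(p′+l)`, `e₁ μ = ∂_{1,μ}(p′)`, `Δ l = Δ(p′+l)`; `a` = the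
parameter of `Δ_a`) together with the finitely many scalar properties of these functions that
the boundedness argument uses — the Prop-valued fields of `Fiber`, grouped E1–E4 below; they
are HYPOTHESES of everything proved here (for Bałaban's functions they are the content of the
tree lemmas `B5Prop11Leaves.DeltaXir_shift_ge_four`, `.Delta1r_le_DeltaXir_shift`,
`.DeltaXir_le_Delta1r`, `.Delta1r_le`, `.uFactorr_le_one`, `.Ur_le_one`, `.S0_le_one`,
`.ineq185_lower` and of `B4Strip`, with `c_u = (2/π)^{2d}` — the paper's "inequality (1.36)" —,
`c_uv = (2/π)^{2d+2}`, `κ = π²/4`; the packaging of those lemmas into a term of type `Fiber`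
is NOT done in this file, see "not certified" (2)).  Over this structure:

* `Fiber.G` — the fiber matrix of (1.83) at `p′`, entry by entry as printed (index
  `(l, μ)`; `Fiber.x`, `Fiber.b`, `Fiber.X`, `Fiber.φ`, `Fiber.Φ` are the printed
  sub-expressions, `Fiber.φ` is (1.84) verbatim).
* `Fiber.sandwich_G_eq` — the algebra behind (1.87)/(1.88): for ARBITRARY diagonal weights
  `w₁ w₂ : Λ → ℂ` the weighted fiber matrix `D_{w₁} G(p′) D_{w₂}^*` (`sandwich w₁ w₂ G`) equals
  (a diagonal matrix whose `(0, μ)` entries carry the `l′ = l` cancellation of (1.87),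
  `Fiber.O00`) + (three block-rank-one matrices) + (one rank-one matrix); `Fiber.b_o_eq` /
  `Fiber.r_eq` is the `l″ = l` cancellation of (1.88) as an identity.
* `Fiber.opNorm_sandwich_G_le` — THE BOUND: if the weights satisfy `Fiber.Wt`
  (`|w_i(l)|, |w₁(l)w₂(l)| ≤ Δ(p′+l)` for `l ≠ 0` and `≤ max(1, Δ(p′))` at `l = 0`; this holds
  for products of lattice-derivative symbols of total order `j₁ + j₂ ≤ 2`, i.e.
  `|w_i(l)|² ≤ Δ(p′+l)^{j_i}` — `Fiber.Wt_of_orders`), then the `ℓ² → ℓ²` operator norm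
  (Mathlib's `Matrix.instL2OpNormedAddCommGroup`, as in `MatrixNorms`) obeys
  `‖D_{w₁} G(p′) D_{w₂}^*‖ ≤ gamma0inv d a c_u c_uv κ`, an EXPLICIT rational function of `d`,
  `a` and the three leaf constants ONLY — independent of `p′`, of `k` (the size of `Λ`) and of
  the torus `T_η`.  Corollaries `Fiber.opNorm_G_le` (no weights) and
  `Fiber.opNorm_sandwich_G_le_of_orders`.
* `Fiber.G_isHermitian` — each fiber matrix is Hermitian ("G is a symmetric operator").
* `opNorm_sandwich_G₀_le` — the fiber `p′ = 0` ((1.83), second and third equalities) is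
  `diag(a⁻¹ at l = 0, Δ(l)⁻¹ else)`, bounded with its weights by `max(a⁻¹, 1)`.

## What is NOT certified here (stated, not kernel-checked)

1. The identification `‖D₁ G D₂^*‖_{L²(T_η)→L²(T_η)} = sup_{p′} ‖D₁(p′) G(p′) D₂(p′)^*‖_{ℓ²→ℓ²}`
   for operators commuting with the coarse translations (Plancherel on the finite torus,
   [folklore]) and the reading of `∇, ∇*, ∇∇, ∇*∇*` in (1.89) as fiber multipliers by
   `∂_ν(p′+l)`, `conj ∂_ν(p′+l)` and their products, composed with coordinate maps of norm
   `≤ 1` — so that each of the six operators of (1.89) is a sum of at most `d²` sandwiches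
   `D_{w₁} G D_{w₂}^*` with weights of total order `≤ 2` — are NOT formalised; only the fiber
   matrices are.
2. The instantiation of the abstract leaves E1–E4 by the trigonometric functions of B5 §1 is
   not carried out here (dictionary residual; the inequalities themselves are the tree lemmas
   listed above).
3. (1.90) `Δ_a = G⁻¹ ≥ γ₀(Δ + I)` is not derived here.
4. No value of `γ₀` is attributed to the paper: `gamma0inv` is OUR constant (the paper prints
   none); its dependence on `(d, a, c_u, c_uv, κ)` alone — not its size — is the content.
-/

open scoped BigOperators Matrix ComplexConjugate Matrix.Norms.L2Operator
open Finset

namespace Literature.MathematicalPhysics.QuantumFieldTheory.Balaban1983to89.B5Prop11Bound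

noncomputable section

/-! ## A. Operator-norm toolkit on `ℓ²` of a finite index set [folklore] -/

section Toolkit

variable {ι : Type*} [Fintype ι]

/-- `|x|₂ := (Σ_i |x_i|²)^{1/2}`. [folklore] -/
def l2n (x : ι → ℂ) : ℝ := √(∑ i, ‖x i‖ ^ 2)

/-- `0 ≤ Σ_i |x_i|²`. [folklore] -/
lemma sum_norm_sq_nonneg (x : ι → ℂ) : 0 ≤ ∑ i, ‖x i‖ ^ 2 :=
  Finset.sum_nonneg fun _ _ => sq_nonneg _

/-- `0 ≤ |x|₂`. [folklore] -/
lemma l2n_nonneg (x : ι → ℂ) : 0 ≤ l2n x := Real.sqrt_nonneg _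

/-- `|x|₂² = Σ_i |x_i|²`. [folklore] -/
lemma l2n_sq (x : ι → ℂ) : l2n x ^ 2 = ∑ i, ‖x i‖ ^ 2 := Real.sq_sqrt (sum_norm_sq_nonneg x)

/-- `Σ_i |x_i|² ≤ C²` with `C ≥ 0` gives `|x|₂ ≤ C`. [folklore] -/
lemma l2n_le_of_sq_le {x : ι → ℂ} {C : ℝ} (hC : 0 ≤ C) (h : ∑ i, ‖x i‖ ^ 2 ≤ C ^ 2) :
    l2n x ≤ C := by
  rw [l2n, ← Real.sqrt_sq hC]
  exact Real.sqrt_le_sqrt h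

/-- `|x|₂ |y|₂ ≤ C` as soon as `|x|₂², |y|₂² ≤ C` (AM–GM). [folklore] -/
lemma l2n_mul_l2n_le {x y : ι → ℂ} {C : ℝ} (hx : ∑ i, ‖x i‖ ^ 2 ≤ C)
    (hy : ∑ i, ‖y i‖ ^ 2 ≤ C) : l2n x * l2n y ≤ C := by
  have h := two_mul_le_add_sq (l2n x) (l2n y)
  rw [l2n_sq, l2n_sq] at h
  linarith

/-- the norm of `EuclideanSpace ℂ ι` is `|·|₂` of the coordinates. [folklore] -/
lemma norm_eq_l2n (ψ : EuclideanSpace ℂ ι) : ‖ψ‖ = l2n (fun i => ψ i) := by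
  rw [l2n, EuclideanSpace.norm_eq]

/-- Cauchy–Schwarz: `|Σ_j c_j ψ_j| ≤ |c|₂ |ψ|₂`. [folklore] -/
lemma norm_sum_mul_le (c ψ : ι → ℂ) : ‖∑ j, c j * ψ j‖ ≤ l2n c * l2n ψ := by
  have h1 : ‖∑ j, c j * ψ j‖ ≤ ∑ j, ‖c j‖ * ‖ψ j‖ :=
    (norm_sum_le _ _).trans_eq (Finset.sum_congr rfl fun j _ => norm_mul _ _)
  have h2 : (∑ j, ‖c j‖ * ‖ψ j‖) ^ 2 ≤ (∑ j, ‖c j‖ ^ 2) * ∑ j, ‖ψ j‖ ^ 2 :=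
    Finset.sum_mul_sq_le_sq_mul_sq _ _ _
  have h0 : 0 ≤ ∑ j, ‖c j‖ * ‖ψ j‖ :=
    Finset.sum_nonneg fun j _ => mul_nonneg (norm_nonneg _) (norm_nonneg _)
  have h3 : ∑ j, ‖c j‖ * ‖ψ j‖ ≤ l2n c * l2n ψ := by
    rw [l2n, l2n, ← Real.sqrt_mul (sum_norm_sq_nonneg c), ← Real.sqrt_sq h0]
    exact Real.sqrt_le_sqrt h2
  exact h1.trans h3

variable [DecidableEq ι]

/-- entries of `A ψ`. [folklore] -/
lemma toEuclideanCLM_apply (A : Matrix ι ι ℂ) (ψ : EuclideanSpace ℂ ι) (i : ι) :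
    (Matrix.toEuclideanCLM (n := ι) (𝕜 := ℂ) A ψ) i = ∑ j, A i j * ψ j := by
  rw [Matrix.ofLp_toEuclideanCLM]
  rfl

/-- `‖A + B + C + D + E‖ ≤ ‖A‖ + ‖B‖ + ‖C‖ + ‖D‖ + ‖E‖`. [folklore] -/
lemma norm_add₅_le {E : Type*} [SeminormedAddCommGroup E] (A B C D E' : E) :
    ‖A + B + C + D + E'‖ ≤ ‖A‖ + ‖B‖ + ‖C‖ + ‖D‖ + ‖E'‖ := by
  have h1 := norm_add_le (A + B + C + D) E'
  have h2 := norm_add_le (A + B + C) D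
  have h3 := norm_add_le (A + B) C
  have h4 := norm_add_le A B
  linarith

/-- `|diag(c)| ≤ C` if all `|c_i| ≤ C` (Mathlib: `Matrix.l2_opNorm_diagonal`). [folklore] -/
lemma opNorm_diagonal_le {c : ι → ℂ} {C : ℝ} (hC : 0 ≤ C) (h : ∀ i, ‖c i‖ ≤ C) :
    ‖(Matrix.diagonal c : Matrix ι ι ℂ)‖ ≤ C := by
  rw [Matrix.l2_opNorm_diagonal]
  exact (pi_norm_le_iff_of_nonneg hC).mpr h

/-- the rank-one matrix `c · x ⊗ ȳ`: `(i, j) ↦ c x_i conj(y_j)`. [folklore] -/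
def rankOne (c : ℂ) (x y : ι → ℂ) : Matrix ι ι ℂ := fun i j => c * x i * conj (y j)

/-- `|c · x ⊗ ȳ| ≤ |c| |x|₂ |y|₂`. [folklore] -/
lemma opNorm_rankOne_le (c : ℂ) (x y : ι → ℂ) {K : ℝ} (hK : 0 ≤ K)
    (h : ‖c‖ * (l2n x * l2n y) ≤ K) : ‖rankOne c x y‖ ≤ K := by
  refine MatrixNorms.opNorm_le_of_bound _ hK fun ψ => ?_
  set s : ℂ := ∑ j, conj (y j) * ψ j with hs
  have hentry : ∀ i, (Matrix.toEuclideanCLM (n := ι) (𝕜 := ℂ) (rankOne c x y) ψ) i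
      = c * x i * s := by
    intro i
    rw [toEuclideanCLM_apply, hs, Finset.mul_sum]
    refine Finset.sum_congr rfl fun j _ => ?_
    simp only [rankOne]
    ring
  have hs_le : ‖s‖ ≤ l2n y * ‖ψ‖ := by
    have h1 := norm_sum_mul_le (fun j => conj (y j)) (fun j => ψ j)
    have h2 : l2n (fun j => conj (y j)) = l2n y := by simp only [l2n, Complex.norm_conj]
    have h3 : l2n (fun j => ψ j) = ‖ψ‖ := (norm_eq_l2n ψ).symm
    rw [h2, h3] at h1
    exact h1
  have hnorm : ‖Matrix.toEuclideanCLM (n := ι) (𝕜 := ℂ) (rankOne c x y) ψ‖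
      = ‖c‖ * l2n x * ‖s‖ := by
    rw [norm_eq_l2n]
    simp only [l2n]
    rw [← Real.sqrt_sq (norm_nonneg c), ← Real.sqrt_sq (norm_nonneg s),
      ← Real.sqrt_mul (sq_nonneg _), ← Real.sqrt_mul (mul_nonneg (sq_nonneg _) (sum_norm_sq_nonneg x))]
    congr 1
    rw [Finset.mul_sum, Finset.sum_mul]
    refine Finset.sum_congr rfl fun i _ => ?_
    rw [hentry i, norm_mul, norm_mul]
    ring
  calc ‖Matrix.toEuclideanCLM (n := ι) (𝕜 := ℂ) (rankOne c x y) ψ‖ = ‖c‖ * l2n x * ‖s‖ := hnorm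
    _ ≤ ‖c‖ * l2n x * (l2n y * ‖ψ‖) :=
        mul_le_mul_of_nonneg_left hs_le (mul_nonneg (norm_nonneg _) (l2n_nonneg _))
    _ = ‖c‖ * (l2n x * l2n y) * ‖ψ‖ := by ring
    _ ≤ K * ‖ψ‖ := mul_le_mul_of_nonneg_right h (norm_nonneg _)

variable {α β : Type*} [Fintype α] [DecidableEq α] [Fintype β] [DecidableEq β]

/-- block-diagonal (in the second index) matrix with rank-one blocks:
`((l, μ), (l′, ν)) ↦ δ_{μν} c_μ y₁(μ, l) conj(y₂(μ, l′))`. [folklore] -/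
def blockR (c : β → ℂ) (y₁ y₂ : β → α → ℂ) : Matrix (α × β) (α × β) ℂ :=
  fun i j => if i.2 = j.2 then c i.2 * y₁ i.2 i.1 * conj (y₂ i.2 j.1) else 0

/-- `|blockR c y₁ y₂| ≤ max_μ |c_μ| |y₁(μ)|₂ |y₂(μ)|₂`. [folklore] -/
lemma opNorm_blockR_le (c : β → ℂ) (y₁ y₂ : β → α → ℂ) {K : ℝ} (hK : 0 ≤ K)
    (h : ∀ μ, ‖c μ‖ * (l2n (y₁ μ) * l2n (y₂ μ)) ≤ K) : ‖blockR c y₁ y₂‖ ≤ K := by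
  refine MatrixNorms.opNorm_le_of_bound _ hK fun ψ => ?_
  set s : β → ℂ := fun μ => ∑ l, conj (y₂ μ l) * ψ (l, μ) with hs
  have hentry : ∀ i : α × β,
      (Matrix.toEuclideanCLM (n := α × β) (𝕜 := ℂ) (blockR c y₁ y₂) ψ) i
        = c i.2 * y₁ i.2 i.1 * s i.2 := by
    intro i
    rw [toEuclideanCLM_apply, Fintype.sum_prod_type]
    simp only [blockR, ite_mul, zero_mul, Finset.sum_ite_eq, Finset.mem_univ, if_true]
    simp only [hs]
    rw [Finset.mul_sum]
    refine Finset.sum_congr rfl fun l _ => ?_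
    ring
  have hs_le : ∀ μ, ‖s μ‖ ≤ l2n (y₂ μ) * l2n (fun l => ψ (l, μ)) := by
    intro μ
    have h1 := norm_sum_mul_le (fun l => conj (y₂ μ l)) (fun l => ψ (l, μ))
    have h2 : l2n (fun l => conj (y₂ μ l)) = l2n (y₂ μ) := by
      simp only [l2n, Complex.norm_conj]
    rw [h2] at h1
    exact h1
  have hsq : ‖Matrix.toEuclideanCLM (n := α × β) (𝕜 := ℂ) (blockR c y₁ y₂) ψ‖ ^ 2
      ≤ (K * ‖ψ‖) ^ 2 := by
    rw [EuclideanSpace.norm_sq_eq, Fintype.sum_prod_type_right, mul_pow, EuclideanSpace.norm_sq_eq,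
      Fintype.sum_prod_type_right, Finset.mul_sum]
    refine Finset.sum_le_sum fun μ _ => ?_
    have hl2 : ∑ l, ‖ψ (l, μ)‖ ^ 2 = l2n (fun l => ψ (l, μ)) ^ 2 := (l2n_sq _).symm
    calc ∑ l, ‖(Matrix.toEuclideanCLM (n := α × β) (𝕜 := ℂ) (blockR c y₁ y₂) ψ) (l, μ)‖ ^ 2
        = (‖c μ‖ * l2n (y₁ μ)) ^ 2 * ‖s μ‖ ^ 2 := by
          rw [mul_pow, l2n_sq, Finset.mul_sum, Finset.sum_mul]
          refine Finset.sum_congr rfl fun l _ => ?_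
          rw [hentry (l, μ), norm_mul, norm_mul]
          ring
      _ ≤ (‖c μ‖ * l2n (y₁ μ)) ^ 2 * (l2n (y₂ μ) * l2n (fun l => ψ (l, μ))) ^ 2 :=
          mul_le_mul_of_nonneg_left (pow_le_pow_left₀ (norm_nonneg _) (hs_le μ) 2) (sq_nonneg _)
      _ = (‖c μ‖ * (l2n (y₁ μ) * l2n (y₂ μ))) ^ 2 * l2n (fun l => ψ (l, μ)) ^ 2 := by ring
      _ ≤ K ^ 2 * l2n (fun l => ψ (l, μ)) ^ 2 := by
          have h0 : 0 ≤ ‖c μ‖ * (l2n (y₁ μ) * l2n (y₂ μ)) :=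
            mul_nonneg (norm_nonneg _) (mul_nonneg (l2n_nonneg _) (l2n_nonneg _))
          exact mul_le_mul_of_nonneg_right (pow_le_pow_left₀ h0 (h μ) 2) (sq_nonneg _)
      _ = K ^ 2 * ∑ l, ‖ψ (l, μ)‖ ^ 2 := by rw [hl2]
  have h0 : 0 ≤ K * ‖ψ‖ := mul_nonneg hK (norm_nonneg _)
  exact (sq_le_sq₀ (norm_nonneg _) h0).mp hsq

end Toolkit

/-! ## B. Diagonal weights ("sandwiches") on `ℓ²(Λ × {1,…,d})` -/

section Sandwich

variable {Λ : Type*} {d : ℕ}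

/-- `D_{w₁} A D_{w₂}^*`: `((l,μ),(l′,ν)) ↦ w₁(l) A_{(l,μ),(l′,ν)} conj(w₂(l′))`
(a derivative symbol `∂_ν(p′+l)` acting on the left, `conj ∂_ν(p′+l′)` = the symbol of `∇*`
acting on the right). [folklore] -/
def sandwich (w₁ w₂ : Λ → ℂ) (A : Matrix (Λ × Fin d) (Λ × Fin d) ℂ) :
    Matrix (Λ × Fin d) (Λ × Fin d) ℂ := fun i j => w₁ i.1 * A i j * conj (w₂ j.1)

/-- `D_1 A D_1^* = A`. [folklore] -/
lemma sandwich_one (A : Matrix (Λ × Fin d) (Λ × Fin d) ℂ) :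
    sandwich (fun _ => (1 : ℂ)) (fun _ => (1 : ℂ)) A = A := by
  ext i j
  simp [sandwich]

variable [Fintype Λ] [DecidableEq Λ]

/-- `sandwich w₁ w₂ A = diag(w₁) · A · diag(w₂)ᴴ`. [folklore] -/
lemma sandwich_eq_diagonal_mul (w₁ w₂ : Λ → ℂ) (A : Matrix (Λ × Fin d) (Λ × Fin d) ℂ) :
    sandwich w₁ w₂ A = Matrix.diagonal (fun i : Λ × Fin d => w₁ i.1) * A *
      (Matrix.diagonal (fun j : Λ × Fin d => w₂ j.1))ᴴ := by
  ext i j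
  simp only [sandwich, Matrix.diagonal_conjTranspose, Matrix.mul_diagonal, Matrix.diagonal_mul,
    Pi.star_apply, Complex.star_def]

end Sandwich

/-! ## C. The constants (OURS — the paper prints none; functions of `d, a, c_u, c_uv, κ` only) -/

section Constants

/-- `K₀₀ := (1 + a/4) · max{(a c_uv)⁻¹, 1}` — bound for the diagonal group. [folklore] -/
def K00 (a cuv : ℝ) : ℝ := (1 + a / 4) * max (1 / (a * cuv)) 1

/-- `F₁ := c_uv⁻¹ + a` — bound for each of the two cross terms of the second group. [folklore] -/
def F1 (a cuv : ℝ) : ℝ := 1 / cuv + a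

/-- `γ₊ := 4d + a + ad` — an upper constant for (1.85): `Δ₀(p′) φ_μ(p′) ≤ γ₊`. [folklore] -/
def gammaPlus (d : ℕ) (a : ℝ) : ℝ := 4 * d + a + a * d

/-- `B := 1 + a/4 + a d κ/4` — bound for (the normalised) curly bracket of (1.88) at `l = 0`.
[folklore] -/
def Bconst (d : ℕ) (a κ : ℝ) : ℝ := 1 + a / 4 + a * d * κ / 4

/-- `C₀` — `|w(0)| |b(0, μ)| ≤ C₀ Δ₀(p′)`. [folklore] -/
def C0 (d : ℕ) (a cu cuv κ : ℝ) : ℝ :=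
  (1 + 4 * d * κ) ^ 2 * (1 / cu) * Bconst d a κ * (κ / (a * cuv))

/-- `C_l` — `|w(l)| |b(l, μ)| ≤ |u(p′+l)| C_l Δ₀(p′)` for `l ≠ 0`. [folklore] -/
def Cl (d : ℕ) (cu cuv κ : ℝ) : ℝ := 2 * d * κ ^ 2 / cu + 2 * κ / cuv

/-- `C_b²` — `Σ_{(l,μ)} |w(l) b(l,μ)|² ≤ C_b² Δ₀(p′)²`. [folklore] -/
def Cb2 (d : ℕ) (a cu cuv κ : ℝ) : ℝ := d * (C0 d a cu cuv κ ^ 2 + Cl d cu cuv κ ^ 2)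

/-- OUR `γ₀⁻¹` (the paper prints none): a function of `d, a, c_u, c_uv, κ` only. [folklore] -/
def gamma0inv (d : ℕ) (a cu cuv κ : ℝ) : ℝ :=
  K00 a cuv + a + 2 * F1 a cuv + gammaPlus d a * Cb2 d a cu cuv κ / a

end Constants

/-! ## D. The abstract fiber of (1.83) -/

/-- The data of (1.83) at one fiber `p′ ≠ 0`, with the scalar properties E1–E4 used by the
boundedness argument.  `o : Λ` is the offset `l = 0`; `u l = u(p′+l)`, `v μ l = v_μ(p′+l)`,
`e μ l = ∂_μ(p′+l)`, `e₁ μ = ∂_{1,μ}(p′)`, `Δ l = Δ(p′+l)`; `cu, cuv, κ` are the three leaf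
constants (`|u(p′)|² ≥ c_u`, `|u(p′) v_μ(p′)|² ≥ c_uv`, `Δ(p′) ≤ κ Δ₀(p′)`). [folklore] -/
structure Fiber (Λ : Type*) [Fintype Λ] [DecidableEq Λ] (d : ℕ) where
  /-- the offset `l = 0` -/
  o : Λ
  /-- the parameter `a > 0` of `Δ_a` -/
  a : ℝ
  /-- leaf constant: `c_u ≤ |u(p′)|²` -/
  cu : ℝ
  /-- leaf constant: `c_uv ≤ |u(p′) v_μ(p′)|²` -/
  cuv : ℝ
  /-- leaf constant: `Δ(p′) ≤ κ Δ₀(p′)` -/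
  κ : ℝ
  /-- `Δ(p′ + l)` -/
  Δ : Λ → ℝ
  /-- `u(p′ + l)` -/
  u : Λ → ℂ
  /-- `v_μ(p′ + l)` -/
  v : Fin d → Λ → ℂ
  /-- `∂_μ(p′ + l)` -/
  e : Fin d → Λ → ℂ
  /-- `∂_{1,μ}(p′)` -/
  e₁ : Fin d → ℂ
  a_pos : 0 < a
  cu_pos : 0 < cu
  cuv_pos : 0 < cuv
  /-- E1 (definition of `v_μ`): `∂_{1,μ}(p′) = v_μ(p′+l) ∂_μ(p′+l)` -/
  e₁_eq : ∀ μ l, e₁ μ = v μ l * e μ l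
  /-- E1: `|∂_μ(p)|² ≤ Δ(p) = Σ_ν |∂_ν(p)|²` -/
  norm_e_sq_le : ∀ μ l, ‖e μ l‖ ^ 2 ≤ Δ l
  /-- E1: `|∂_{1,μ}(p′)| = |e^{i p′_μ} − 1| ≤ 2` -/
  norm_e₁_le : ∀ μ, ‖e₁ μ‖ ≤ 2
  /-- E2: `p′ ≠ 0`, i.e. `Δ₀(p′) > 0` -/
  Δ₀_pos : 0 < ∑ μ, ‖e₁ μ‖ ^ 2
  /-- E2: `Δ(p′ + l) ≥ 4` for `l ≠ 0` (`DeltaXir_shift_ge_four`) -/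
  four_le : ∀ l, l ≠ o → 4 ≤ Δ l
  /-- E2: `Δ₀(p′) ≤ Δ(p′)` (`Delta1r_le_DeltaXir_shift`) -/
  Δ₀_le_Δo : ∑ μ, ‖e₁ μ‖ ^ 2 ≤ Δ o
  /-- E2: `Δ(p′) ≤ κ Δ₀(p′)` (`DeltaXir_le_Delta1r`, `κ = π²/4`) -/
  Δo_le : Δ o ≤ κ * ∑ μ, ‖e₁ μ‖ ^ 2
  /-- E3: `|v_μ| ≤ 1` (`uFactorr_le_one`) -/
  norm_v_le : ∀ μ l, ‖v μ l‖ ≤ 1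
  /-- E3: `|u| ≤ 1` (`Ur_le_one`) -/
  norm_u_le : ∀ l, ‖u l‖ ≤ 1
  /-- E3: `|u(p′)|² ≥ c_u` ("the inequality (1.36)"; `c_u = (2/π)^{2d}`) -/
  cu_le : cu ≤ ‖u o‖ ^ 2
  /-- E3: `|u(p′) v_μ(p′)|² ≥ c_uv` (`ineq185_lower`; `c_uv = (2/π)^{2d+2}`) -/
  cuv_le : ∀ μ, cuv ≤ ‖u o * v μ o‖ ^ 2
  /-- E4: `Σ_{l ≠ 0} |u(p′+l)|² ≤ 1` (`S0_le_one`, from `Σ_l |u(p′+l)|² = 1`) -/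
  S₀_le : ∑ l ∈ Finset.univ.erase o, ‖u l‖ ^ 2 ≤ 1

namespace Fiber

variable {Λ : Type*} [Fintype Λ] [DecidableEq Λ] {d : ℕ} (F : Fiber Λ d)

/-! ### D.1 The printed sub-expressions of (1.83) and the fiber matrix -/

/-- `Δ₀(p′) = Σ_μ |∂_{1,μ}(p′)|²`. [folklore] -/
def Δ₀ : ℝ := ∑ μ, ‖F.e₁ μ‖ ^ 2

/-- `max(1, Δ(p′))`: the admissible size of a weight at `l = 0`. [folklore] -/
def M : ℝ := max 1 (F.Δ F.o)

/-- `S₀ = Σ_{l ≠ 0} |u(p′+l)|²`. [folklore] -/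
def S₀ : ℝ := ∑ l ∈ univ.erase F.o, ‖F.u l‖ ^ 2

/-- `S₁(μ) = Σ_{l ≠ 0} |u(p′+l) v_μ(p′+l)|² / Δ(p′+l)`. [folklore] -/
def S₁ (μ : Fin d) : ℝ := ∑ l ∈ univ.erase F.o, ‖F.u l * F.v μ l‖ ^ 2 / F.Δ l

/-- `S₂ = Σ_{l ≠ 0} |u(p′+l)|² / Δ²(p′+l)`. [folklore] -/
def S₂ : ℝ := ∑ l ∈ univ.erase F.o, ‖F.u l‖ ^ 2 / F.Δ l ^ 2

/-- `X(p′) = Σ_{l″} |u(p′+l″)|² / Δ²(p′+l″)` (the sum inverted in the square brackets of (1.83)).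
[cite: Balaban1984PropagatorsI, (1.83) p.31] -/
def X : ℝ := ∑ l, ‖F.u l‖ ^ 2 / F.Δ l ^ 2

/-- (1.84): `φ_μ(p′) = 1 + a Σ_{l″} |u(p′+l″)|² |v_μ(p′+l″)|² / Δ(p′+l″)`.
[cite: Balaban1984PropagatorsI, (1.84) p.31] -/
def φ (μ : Fin d) : ℝ := 1 + F.a * ∑ l, ‖F.u l * F.v μ l‖ ^ 2 / F.Δ l

/-- `Φ(p′) = Σ_λ |∂_{1,λ}(p′)|² / φ_λ(p′)` (the sum inverted after `a⁻¹` in (1.83)).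
[cite: Balaban1984PropagatorsI, (1.83) p.31] -/
def Φ : ℝ := ∑ μ, ‖F.e₁ μ‖ ^ 2 / F.φ μ

/-- `x_μ(l) := conj[u(p′+l) v_μ(p′+l)] / Δ(p′+l)`. [cite: Balaban1984PropagatorsI, (1.83) p.31] -/
def x (μ : Fin d) (l : Λ) : ℂ := conj (F.u l * F.v μ l) / (F.Δ l : ℂ)

/-- the first square bracket of (1.83): `b(l, μ)`. [cite: Balaban1984PropagatorsI, (1.83) p.31] -/
def b (l : Λ) (μ : Fin d) : ℂ :=
  F.e μ l * conj (F.u l) / ((F.Δ l : ℂ) ^ 2 * (F.X : ℂ))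
    - (F.a : ℂ) * conj (F.u l * F.v μ l) * F.e₁ μ / ((F.φ μ : ℂ) * (F.Δ l : ℂ))

/-- the scalar `a⁻¹ Φ(p′)⁻¹` between the two square brackets of (1.83).
[cite: Balaban1984PropagatorsI, (1.83) p.31] -/
def cT : ℂ := 1 / ((F.a : ℂ) * (F.Φ : ℂ))

/-- THE FIBER MATRIX OF (1.83) at `p′ ≠ 0`, index `(l, μ)`:
`G_{(l,μ),(l′,ν)} = δ_{μν} [δ_{ll′}/Δ(p′+l) − a φ_μ⁻¹ x_μ(l) conj x_μ(l′)]
                   + a⁻¹ Φ⁻¹ b(l,μ) conj b(l′,ν)`. [cite: Balaban1984PropagatorsI, (1.83) p.31] -/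
def G : Matrix (Λ × Fin d) (Λ × Fin d) ℂ := fun i j =>
  (if i.2 = j.2 then
      (if i.1 = j.1 then 1 / (F.Δ i.1 : ℂ) else 0)
        - (F.a : ℂ) / (F.φ i.2 : ℂ) * F.x i.2 i.1 * conj (F.x i.2 j.1)
    else 0)
  + F.cT * F.b i.1 i.2 * conj (F.b j.1 j.2)

/-! ### D.2 The pieces of the decomposition of `D_{w₁} G D_{w₂}^*` -/

/-- diagonal piece; at `l = 0` the entry carries the `l′ = l` cancellation of (1.87):
`1/Δ(p′) − a φ_μ⁻¹ |x_μ(0)|² = (1 + a S₁(μ)) / (φ_μ Δ(p′))`. [folklore] -/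
def dg (w₁ w₂ : Λ → ℂ) (i : Λ × Fin d) : ℂ :=
  if i.1 = F.o then
    w₁ F.o * conj (w₂ F.o) * ((1 + (F.a : ℂ) * (F.S₁ i.2 : ℂ)) / ((F.φ i.2 : ℂ) * (F.Δ F.o : ℂ)))
  else w₁ i.1 * conj (w₂ i.1) * (1 / (F.Δ i.1 : ℂ))

/-- `−a φ_μ⁻¹`. [folklore] -/
def cR (μ : Fin d) : ℂ := -((F.a : ℂ) / (F.φ μ : ℂ))

/-- `w(l) x_μ(l)` restricted to `l ≠ 0`. [folklore] -/
def xw (w : Λ → ℂ) (μ : Fin d) (l : Λ) : ℂ := if l = F.o then 0 else w l * F.x μ l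

/-- `w(0) x_μ(0)` supported at `l = 0`. [folklore] -/
def xo (w : Λ → ℂ) (μ : Fin d) (l : Λ) : ℂ := if l = F.o then w F.o * F.x μ F.o else 0

/-- `w(l) b(l, μ)`. [folklore] -/
def bw (w : Λ → ℂ) (i : Λ × Fin d) : ℂ := w i.1 * F.b i.1 i.2

/-! ### D.3 Scalar consequences of E1–E4 -/

/-- `Δ₀(p′) = Σ_μ |∂_{1,μ}(p′)|²` (unfolding lemma). [folklore] -/
lemma Δ₀_def : F.Δ₀ = ∑ μ, ‖F.e₁ μ‖ ^ 2 := rfl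

/-- E2: `Δ₀(p′) > 0`. [folklore] -/
lemma Δ₀_pos' : 0 < F.Δ₀ := F.Δ₀_pos

/-- E2: `Δ₀(p′) ≤ Δ(p′)`. [folklore] -/
lemma Δ₀_le_Δo' : F.Δ₀ ≤ F.Δ F.o := F.Δ₀_le_Δo

/-- E2: `Δ(p′) ≤ κ Δ₀(p′)`. [folklore] -/
lemma Δo_le' : F.Δ F.o ≤ F.κ * F.Δ₀ := F.Δo_le

/-- `Δ(p′) > 0`. [folklore] -/
lemma Δo_pos : 0 < F.Δ F.o := F.Δ₀_pos'.trans_le F.Δ₀_le_Δo'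

/-- `Δ(p′+l) > 0` for every `l`. [folklore] -/
lemma Δ_pos (l : Λ) : 0 < F.Δ l := by
  by_cases hl : l = F.o
  · rw [hl]; exact F.Δo_pos
  · exact lt_of_lt_of_le (by norm_num) (F.four_le l hl)

/-- `Δ(p′+l) ≥ 1` for `l ≠ 0`. [folklore] -/
lemma one_le_Δ {l : Λ} (hl : l ≠ F.o) : 1 ≤ F.Δ l := le_trans (by norm_num) (F.four_le l hl)

/-- `κ ≥ 1` (from `0 < Δ₀ ≤ Δ(p′) ≤ κΔ₀`). [folklore] -/
lemma one_le_κ : 1 ≤ F.κ := by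
  have h : 1 * F.Δ₀ ≤ F.κ * F.Δ₀ := by rw [one_mul]; exact F.Δ₀_le_Δo'.trans F.Δo_le'
  exact le_of_mul_le_mul_right h F.Δ₀_pos'

/-- `κ > 0`. [folklore] -/
lemma κ_pos : 0 < F.κ := lt_of_lt_of_le one_pos F.one_le_κ

/-- `|∂_{1,μ}(p′)|² ≤ 4`. [folklore] -/
lemma norm_e₁_sq_le (μ : Fin d) : ‖F.e₁ μ‖ ^ 2 ≤ 4 := by
  have h := F.norm_e₁_le μ
  have h0 := norm_nonneg (F.e₁ μ)
  nlinarith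

/-- `Δ₀(p′) ≤ 4d`. [folklore] -/
lemma Δ₀_le : F.Δ₀ ≤ 4 * d := by
  calc F.Δ₀ = ∑ μ, ‖F.e₁ μ‖ ^ 2 := rfl
    _ ≤ ∑ _μ : Fin d, (4 : ℝ) := Finset.sum_le_sum fun μ _ => F.norm_e₁_sq_le μ
    _ = 4 * d := by
        simp only [Finset.sum_const, Finset.card_univ, Fintype.card_fin, nsmul_eq_mul]
        ring

/-- `Δ(p′) ≤ 4dκ`. [folklore] -/
lemma Δo_le_4dκ : F.Δ F.o ≤ 4 * d * F.κ := by
  have h1 := F.Δo_le'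
  have h2 := F.Δ₀_le
  have hκ := F.κ_pos
  nlinarith

/-- `1 ≤ max(1, Δ(p′))`. [folklore] -/
lemma one_le_M : 1 ≤ F.M := le_max_left _ _

/-- `Δ(p′) ≤ max(1, Δ(p′))`. [folklore] -/
lemma Δo_le_M : F.Δ F.o ≤ F.M := le_max_right _ _

/-- `max(1, Δ(p′)) > 0`. [folklore] -/
lemma M_pos : 0 < F.M := lt_of_lt_of_le one_pos F.one_le_M

/-- `max(1, Δ(p′)) ≤ 1 + 4dκ`. [folklore] -/
lemma M_le : F.M ≤ 1 + 4 * d * F.κ := by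
  have h := F.Δo_le_4dκ
  have h0 : 0 ≤ 4 * (d : ℝ) * F.κ := by
    have := F.κ_pos
    have hd : (0 : ℝ) ≤ d := Nat.cast_nonneg d
    positivity
  exact max_le (by linarith) (by linarith)

/-- `max(1, Δ(p′)) ≤ 1 + Δ(p′)`. [folklore] -/
lemma M_le' : F.M ≤ 1 + F.Δ F.o := max_le (by linarith [F.Δo_pos]) (by linarith)

/-- `|∂_μ(p′)| ≤ 1 + 4 d κ` (from `|∂_μ(p′)|² ≤ Δ(p′) ≤ 4 d κ`). [folklore] -/
lemma norm_e_o_le (μ : Fin d) : ‖F.e μ F.o‖ ≤ 1 + 4 * d * F.κ := by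
  have h1 := F.norm_e_sq_le μ F.o
  have h2 := F.Δo_le_4dκ
  have h0 := norm_nonneg (F.e μ F.o)
  nlinarith [sq_nonneg (‖F.e μ F.o‖ - 1)]

/-- `|∂_μ(p′+l)| ≤ Δ(p′+l)/2` for `l ≠ 0` (from `|∂|² ≤ Δ` and `Δ ≥ 4`). [folklore] -/
lemma norm_e_le_half {l : Λ} (hl : l ≠ F.o) (μ : Fin d) : ‖F.e μ l‖ ≤ F.Δ l / 2 := by
  have h1 := F.norm_e_sq_le μ l
  have h4 := F.four_le l hl
  have hsq : ‖F.e μ l‖ ^ 2 ≤ (F.Δ l / 2) ^ 2 := by nlinarith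
  exact (pow_le_pow_iff_left₀ (norm_nonneg _) (by linarith) two_ne_zero).mp hsq

/-- `|u v_μ|(p′+l) ≤ |u(p′+l)|` (as `|v_μ| ≤ 1`). [folklore] -/
lemma norm_uv_le (μ : Fin d) (l : Λ) : ‖F.u l * F.v μ l‖ ≤ ‖F.u l‖ := by
  rw [norm_mul]
  exact mul_le_of_le_one_right (norm_nonneg _) (F.norm_v_le μ l)

/-- `|u v_μ|²(p′+l) ≤ |u(p′+l)|²`. [folklore] -/
lemma norm_uv_sq_le (μ : Fin d) (l : Λ) : ‖F.u l * F.v μ l‖ ^ 2 ≤ ‖F.u l‖ ^ 2 :=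
  pow_le_pow_left₀ (norm_nonneg _) (F.norm_uv_le μ l) 2

/-- `|u v_μ|(p′) ≤ 1`. [folklore] -/
lemma norm_uvo_le_one (μ : Fin d) : ‖F.u F.o * F.v μ F.o‖ ≤ 1 :=
  (F.norm_uv_le μ F.o).trans (F.norm_u_le F.o)

/-- `|u v_μ|²(p′) ≤ 1`. [folklore] -/
lemma norm_uvo_sq_le_one (μ : Fin d) : ‖F.u F.o * F.v μ F.o‖ ^ 2 ≤ 1 :=
  pow_le_one₀ (norm_nonneg _) (F.norm_uvo_le_one μ)

/-- `S₀ ≥ 0`. [folklore] -/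
lemma S₀_nonneg : 0 ≤ F.S₀ := Finset.sum_nonneg fun _ _ => sq_nonneg _

/-- E4: `S₀ ≤ 1`. [folklore] -/
lemma S₀_le_one : F.S₀ ≤ 1 := F.S₀_le

/-- `S₁(μ) ≥ 0`. [folklore] -/
lemma S₁_nonneg (μ : Fin d) : 0 ≤ F.S₁ μ :=
  Finset.sum_nonneg fun l _ => div_nonneg (sq_nonneg _) (F.Δ_pos l).le

/-- `S₁(μ) ≤ S₀/4 ≤ 1/4` (as `Δ(p′+l) ≥ 4` for `l ≠ 0` and `|v_μ| ≤ 1`). [folklore] -/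
lemma S₁_le (μ : Fin d) : F.S₁ μ ≤ 1 / 4 := by
  calc F.S₁ μ ≤ ∑ l ∈ univ.erase F.o, ‖F.u l‖ ^ 2 / 4 := by
        refine Finset.sum_le_sum fun l hl => ?_
        have hl' : l ≠ F.o := (Finset.mem_erase.mp hl).1
        exact div_le_div₀ (sq_nonneg _) (F.norm_uv_sq_le μ l) (by norm_num) (F.four_le l hl')
    _ = F.S₀ / 4 := by rw [S₀, Finset.sum_div]
    _ ≤ 1 / 4 := by linarith [F.S₀_le_one]

/-- `S₂ ≥ 0`. [folklore] -/
lemma S₂_nonneg : 0 ≤ F.S₂ :=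
  Finset.sum_nonneg fun _ _ => div_nonneg (sq_nonneg _) (sq_nonneg _)

/-- `S₂ ≤ S₀/16 ≤ 1/16` (as `Δ(p′+l)² ≥ 16` for `l ≠ 0`). [folklore] -/
lemma S₂_le : F.S₂ ≤ 1 / 16 := by
  calc F.S₂ ≤ ∑ l ∈ univ.erase F.o, ‖F.u l‖ ^ 2 / 16 := by
        refine Finset.sum_le_sum fun l hl => ?_
        have hl' : l ≠ F.o := (Finset.mem_erase.mp hl).1
        have h16 : (16 : ℝ) ≤ F.Δ l ^ 2 := by nlinarith [F.four_le l hl']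
        exact div_le_div₀ (sq_nonneg _) le_rfl (by norm_num) h16
    _ = F.S₀ / 16 := by rw [S₀, Finset.sum_div]
    _ ≤ 1 / 16 := by linarith [F.S₀_le_one]

/-- (1.84) split at `l″ = 0`. [folklore] -/
lemma φ_eq (μ : Fin d) :
    F.φ μ = 1 + F.a * (‖F.u F.o * F.v μ F.o‖ ^ 2 / F.Δ F.o + F.S₁ μ) := by
  rw [φ, S₁, ← Finset.add_sum_erase univ _ (Finset.mem_univ F.o)]

/-- the sum in (1.84) is non-negative. [folklore] -/
lemma sum_uvΔ_nonneg (μ : Fin d) : 0 ≤ ∑ l, ‖F.u l * F.v μ l‖ ^ 2 / F.Δ l :=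
  Finset.sum_nonneg fun l _ => div_nonneg (sq_nonneg _) (F.Δ_pos l).le

/-- `φ_μ(p′) ≥ 1`. [folklore] -/
lemma one_le_φ (μ : Fin d) : 1 ≤ F.φ μ := by
  have h := F.sum_uvΔ_nonneg μ
  have ha := F.a_pos
  rw [φ]
  nlinarith

/-- `φ_μ(p′) > 0`. [folklore] -/
lemma φ_pos (μ : Fin d) : 0 < F.φ μ := lt_of_lt_of_le one_pos (F.one_le_φ μ)

/-- lower half of (1.85) in the form used here: `Δ(p′) + a |u(p′) v_μ(p′)|² ≤ φ_μ(p′) Δ(p′)`.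
[folklore] -/
lemma φΔo_ge (μ : Fin d) :
    F.Δ F.o + F.a * ‖F.u F.o * F.v μ F.o‖ ^ 2 ≤ F.φ μ * F.Δ F.o := by
  have hΔ := F.Δo_pos
  have hΔ' : F.Δ F.o ≠ 0 := hΔ.ne'
  have hS := F.S₁_nonneg μ
  have ha := F.a_pos
  have h : F.φ μ * F.Δ F.o
      = F.Δ F.o + F.a * ‖F.u F.o * F.v μ F.o‖ ^ 2 + F.a * F.S₁ μ * F.Δ F.o := by
    rw [F.φ_eq μ]
    field_simp
    ring
  rw [h]
  have : 0 ≤ F.a * F.S₁ μ * F.Δ F.o := mul_nonneg (mul_nonneg ha.le hS) hΔ.le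
  linarith

/-- `a c_uv ≤ φ_μ(p′) Δ(p′)`. [folklore] -/
lemma acuv_le_φΔo (μ : Fin d) : F.a * F.cuv ≤ F.φ μ * F.Δ F.o := by
  have h1 := F.φΔo_ge μ
  have h2 := F.cuv_le μ
  have ha := F.a_pos
  have hΔ := F.Δo_pos
  nlinarith

/-- `Δ(p′) + a c_uv ≤ φ_μ(p′) Δ(p′)`. [folklore] -/
lemma Δo_acuv_le_φΔo (μ : Fin d) : F.Δ F.o + F.a * F.cuv ≤ F.φ μ * F.Δ F.o := by
  have h1 := F.φΔo_ge μ
  have h2 := F.cuv_le μ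
  have ha := F.a_pos
  nlinarith

/-- `1/φ_μ(p′) ≤ κ Δ₀(p′)/(a c_uv)`. [folklore] -/
lemma inv_φ_le (μ : Fin d) : 1 / F.φ μ ≤ F.κ * F.Δ₀ / (F.a * F.cuv) := by
  have hφ := F.φ_pos μ
  have ha := F.a_pos
  have hc := F.cuv_pos
  rw [div_le_div_iff₀ hφ (mul_pos ha hc)]
  have h1 := F.acuv_le_φΔo μ
  have h2 := F.Δo_le'
  nlinarith

/-- `γ₊ > 0`. [folklore] -/
lemma gammaPlus_pos : 0 < gammaPlus d F.a := by
  have ha := F.a_pos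
  have hd : (0 : ℝ) ≤ d := Nat.cast_nonneg d
  rw [gammaPlus]
  nlinarith

/-- upper half of (1.85) in the form used here: `φ_μ(p′) Δ₀(p′) ≤ γ₊ = 4d + a + ad`.
[cite: Balaban1984PropagatorsI, (1.85) p.32] -/
lemma φ_mul_Δ₀_le (μ : Fin d) : F.φ μ * F.Δ₀ ≤ gammaPlus d F.a := by
  have hΔo := F.Δo_pos
  have hΔo' : F.Δ F.o ≠ 0 := hΔo.ne'
  have ha := F.a_pos
  have hn := F.norm_uvo_sq_le_one μ
  have hn0 : 0 ≤ ‖F.u F.o * F.v μ F.o‖ ^ 2 := sq_nonneg _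
  have hr : F.Δ₀ / F.Δ F.o ≤ 1 := (div_le_one hΔo).mpr F.Δ₀_le_Δo'
  have hr0 : 0 ≤ F.Δ₀ / F.Δ F.o := div_nonneg F.Δ₀_pos'.le hΔo.le
  have hS := F.S₁_le μ
  have hS0 := F.S₁_nonneg μ
  have hD := F.Δ₀_le
  have hD0 := F.Δ₀_pos'.le
  have h : F.φ μ * F.Δ₀ = F.Δ₀ + F.a * (‖F.u F.o * F.v μ F.o‖ ^ 2 * (F.Δ₀ / F.Δ F.o))
      + F.a * (F.S₁ μ * F.Δ₀) := by
    rw [F.φ_eq μ]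
    field_simp
    ring
  rw [h, gammaPlus]
  have h1 : ‖F.u F.o * F.v μ F.o‖ ^ 2 * (F.Δ₀ / F.Δ F.o) ≤ 1 := mul_le_one₀ hn hr0 hr
  have h2 : F.S₁ μ * F.Δ₀ ≤ 1 / 4 * (4 * d) := mul_le_mul hS hD hD0 (by norm_num)
  have h1' := mul_le_mul_of_nonneg_left h1 ha.le
  have h2' := mul_le_mul_of_nonneg_left h2 ha.le
  nlinarith

/-- `X(p′)` split at `l″ = 0`. [folklore] -/
lemma X_eq : F.X = ‖F.u F.o‖ ^ 2 / F.Δ F.o ^ 2 + F.S₂ := by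
  rw [X, S₂, ← Finset.add_sum_erase univ _ (Finset.mem_univ F.o)]

/-- `|u(p′)|²/Δ(p′)² ≤ X(p′)`. [folklore] -/
lemma uo_term_le_X : ‖F.u F.o‖ ^ 2 / F.Δ F.o ^ 2 ≤ F.X := by
  rw [X_eq]
  linarith [F.S₂_nonneg]

/-- `c_u/Δ(p′)² ≤ X(p′)` ("the inequality (1.36)" enters here). [folklore] -/
lemma cu_div_le_X : F.cu / F.Δ F.o ^ 2 ≤ F.X :=
  le_trans (div_le_div_of_nonneg_right F.cu_le (sq_nonneg _)) F.uo_term_le_X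

/-- `X(p′) > 0`. [folklore] -/
lemma X_pos : 0 < F.X := lt_of_lt_of_le (div_pos F.cu_pos (pow_pos F.Δo_pos 2)) F.cu_div_le_X

/-- `X(p′)⁻¹ ≤ Δ(p′)²/c_u`. [folklore] -/
lemma inv_X_le : 1 / F.X ≤ F.Δ F.o ^ 2 / F.cu := by
  rw [div_le_div_iff₀ F.X_pos F.cu_pos]
  have h := F.cu_div_le_X
  rw [div_le_iff₀ (pow_pos F.Δo_pos 2)] at h
  linarith

/-- `Φ(p′) ≥ Δ₀(p′)²/γ₊` ((1.86) bounded below). [cite: Balaban1984PropagatorsI, (1.86) p.32] -/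
lemma Φ_ge : F.Δ₀ ^ 2 / gammaPlus d F.a ≤ F.Φ := by
  have hγ := F.gammaPlus_pos
  calc F.Δ₀ ^ 2 / gammaPlus d F.a = ∑ μ, ‖F.e₁ μ‖ ^ 2 * (F.Δ₀ / gammaPlus d F.a) := by
        rw [← Finset.sum_mul, ← Δ₀_def]
        ring
    _ ≤ ∑ μ, ‖F.e₁ μ‖ ^ 2 * (1 / F.φ μ) := by
        refine Finset.sum_le_sum fun μ _ => mul_le_mul_of_nonneg_left ?_ (sq_nonneg _)
        rw [div_le_div_iff₀ hγ (F.φ_pos μ)]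
        have := F.φ_mul_Δ₀_le μ
        linarith
    _ = F.Φ := by
        rw [Φ]
        refine Finset.sum_congr rfl fun μ _ => ?_
        rw [mul_one_div]

/-- `Φ(p′) > 0`. [folklore] -/
lemma Φ_pos : 0 < F.Φ :=
  lt_of_lt_of_le (div_pos (pow_pos F.Δ₀_pos' 2) F.gammaPlus_pos) F.Φ_ge

/-- `a⁻¹ Φ(p′)⁻¹ ≤ γ₊ / (a Δ₀(p′)²)`. [folklore] -/
lemma cT_le : 1 / (F.a * F.Φ) ≤ gammaPlus d F.a / (F.a * F.Δ₀ ^ 2) := by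
  have ha := F.a_pos
  have hΦ := F.Φ_pos
  have hD := F.Δ₀_pos'
  rw [div_le_div_iff₀ (mul_pos ha hΦ) (mul_pos ha (pow_pos hD 2))]
  have h := F.Φ_ge
  rw [div_le_iff₀ F.gammaPlus_pos] at h
  nlinarith

/-- `|x_μ(l)| = |u v_μ|(p′+l)/Δ(p′+l)`. [folklore] -/
lemma norm_x (μ : Fin d) (l : Λ) : ‖F.x μ l‖ = ‖F.u l * F.v μ l‖ / F.Δ l := by
  rw [x, norm_div, Complex.norm_conj, Complex.norm_of_nonneg (F.Δ_pos l).le]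

/-- `x_μ(l) conj x_μ(l) = |u v_μ|²(p′+l)/Δ(p′+l)²` (as a real cast). [folklore] -/
lemma x_mul_conj (μ : Fin d) (l : Λ) :
    F.x μ l * conj (F.x μ l) = ((‖F.u l * F.v μ l‖ ^ 2 / F.Δ l ^ 2 : ℝ) : ℂ) := by
  rw [Complex.mul_conj', norm_x]
  push_cast
  ring

/-! ### D.4 The two cancellations -/

/-- (1.87), the cancellation of the terms with `l′ = l (= 0)`:
`1/Δ(p′) − a φ_μ⁻¹ |u(p′)v_μ(p′)|²/Δ(p′)² = (1 + a S₁(μ))/(φ_μ Δ(p′))`.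
[cite: Balaban1984PropagatorsI, (1.87) p.32] -/
lemma O00_real (μ : Fin d) :
    1 / F.Δ F.o - F.a / F.φ μ * (‖F.u F.o * F.v μ F.o‖ ^ 2 / F.Δ F.o ^ 2)
      = (1 + F.a * F.S₁ μ) / (F.φ μ * F.Δ F.o) := by
  have hΔ := F.Δo_pos
  have hφ := F.φ_pos μ
  have hΔ' : F.Δ F.o ≠ 0 := hΔ.ne'
  have hφ' : F.φ μ ≠ 0 := hφ.ne'
  have key : F.φ μ * F.Δ F.o - F.a * ‖F.u F.o * F.v μ F.o‖ ^ 2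
      = F.Δ F.o * (1 + F.a * F.S₁ μ) := by
    rw [F.φ_eq μ]
    field_simp
    ring
  have h1 : (1 + F.a * F.S₁ μ) / (F.φ μ * F.Δ F.o)
      = (F.φ μ * F.Δ F.o - F.a * ‖F.u F.o * F.v μ F.o‖ ^ 2) / (F.φ μ * F.Δ F.o ^ 2) := by
    rw [div_eq_div_iff (mul_ne_zero hφ' hΔ') (mul_ne_zero hφ' (pow_ne_zero 2 hΔ'))]
    linear_combination (-(F.φ μ * F.Δ F.o)) * key
  rw [h1]
  field_simp

/-- (1.87) cancellation, complex form matching the entries of `G`.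
[cite: Balaban1984PropagatorsI, (1.87) p.32] -/
lemma O00 (μ : Fin d) :
    1 / (F.Δ F.o : ℂ) - (F.a : ℂ) / (F.φ μ : ℂ) * (F.x μ F.o * conj (F.x μ F.o))
      = (1 + (F.a : ℂ) * (F.S₁ μ : ℂ)) / ((F.φ μ : ℂ) * (F.Δ F.o : ℂ)) := by
  have h := congrArg (fun r : ℝ => (r : ℂ)) (F.O00_real μ)
  push_cast at h
  rw [x_mul_conj]
  push_cast
  linear_combination h

/-- `r_μ := 1/(Δ(p′)² X) − a |v_μ(p′)|²/(φ_μ Δ(p′))` (real).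
[cite: Balaban1984PropagatorsI, (1.88) p.32] -/
def r (μ : Fin d) : ℝ := 1 / (F.Δ F.o ^ 2 * F.X) - F.a * ‖F.v μ F.o‖ ^ 2 / (F.φ μ * F.Δ F.o)

/-- the curly bracket of (1.88) at `l = 0`, divided by `Δ₀²`:
`Br_μ := 1 + a S₁(μ) − a |v_μ(p′)|² Δ(p′) S₂`. [cite: Balaban1984PropagatorsI, (1.88) p.32] -/
def Br (μ : Fin d) : ℝ := 1 + F.a * F.S₁ μ - F.a * ‖F.v μ F.o‖ ^ 2 * F.Δ F.o * F.S₂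

/-- (1.88) at `l = 0`, step 1: `b(0, μ) = ∂_μ(p′) conj u(p′) · r_μ`
(uses E1 `∂_{1,μ}(p′) = v_μ(p′) ∂_μ(p′)`). [cite: Balaban1984PropagatorsI, (1.88) p.32] -/
lemma b_o_eq (μ : Fin d) : F.b F.o μ = F.e μ F.o * conj (F.u F.o) * (F.r μ : ℂ) := by
  have hv : conj (F.v μ F.o) * F.v μ F.o = ((‖F.v μ F.o‖ ^ 2 : ℝ) : ℂ) := by
    rw [Complex.conj_mul']
    push_cast
    ring
  push_cast at hv
  simp only [b, r, F.e₁_eq μ F.o, map_mul]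
  push_cast
  linear_combination (-(F.a : ℂ) * conj (F.u F.o) * F.e μ F.o / ((F.φ μ : ℂ) * (F.Δ F.o : ℂ))) * hv

/-- `|b(0, μ)| = |∂_μ(p′)| |u(p′)| |r_μ|`. [folklore] -/
lemma norm_b_o (μ : Fin d) : ‖F.b F.o μ‖ = ‖F.e μ F.o‖ * ‖F.u F.o‖ * |F.r μ| := by
  rw [b_o_eq, norm_mul, norm_mul, Complex.norm_conj, Complex.norm_real, Real.norm_eq_abs]

/-- (1.88) at `l = 0`, step 2: the cancellation of the terms with `l″ = l (= 0)`:
`r_μ = Br_μ / (Δ(p′)² X φ_μ)`. [cite: Balaban1984PropagatorsI, (1.88) p.32] -/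
lemma r_eq (μ : Fin d) : F.r μ = F.Br μ / (F.Δ F.o ^ 2 * F.X * F.φ μ) := by
  have hΔ : F.Δ F.o ≠ 0 := F.Δo_pos.ne'
  have hX : F.X ≠ 0 := F.X_pos.ne'
  have hφ : F.φ μ ≠ 0 := (F.φ_pos μ).ne'
  have hn : ‖F.u F.o * F.v μ F.o‖ ^ 2 = ‖F.u F.o‖ ^ 2 * ‖F.v μ F.o‖ ^ 2 := by
    rw [norm_mul, mul_pow]
  rw [eq_div_iff (mul_ne_zero (mul_ne_zero (pow_ne_zero 2 hΔ) hX) hφ), r, Br]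
  have h1 : (1 / (F.Δ F.o ^ 2 * F.X) - F.a * ‖F.v μ F.o‖ ^ 2 / (F.φ μ * F.Δ F.o))
      * (F.Δ F.o ^ 2 * F.X * F.φ μ) = F.φ μ - F.a * ‖F.v μ F.o‖ ^ 2 * F.Δ F.o * F.X := by
    field_simp
  rw [h1, F.φ_eq μ, F.X_eq, hn]
  field_simp
  ring

/-- `B ≥ 0`. [folklore] -/
lemma Bconst_nonneg : 0 ≤ Bconst d F.a F.κ := by
  have ha := F.a_pos.le
  have hκ := F.κ_pos.le
  have hd : (0 : ℝ) ≤ d := Nat.cast_nonneg d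
  rw [Bconst]
  have : 0 ≤ F.a * d * F.κ := mul_nonneg (mul_nonneg ha hd) hκ
  linarith

/-- `|Br_μ| ≤ B = 1 + a/4 + a d κ/4`. [folklore] -/
lemma abs_Br_le (μ : Fin d) : |F.Br μ| ≤ Bconst d F.a F.κ := by
  have ha := F.a_pos.le
  have hS₁ := F.S₁_le μ
  have hS₁0 := F.S₁_nonneg μ
  have hS₂ := F.S₂_le
  have hS₂0 := F.S₂_nonneg
  have hm : ‖F.v μ F.o‖ ^ 2 ≤ 1 := pow_le_one₀ (norm_nonneg _) (F.norm_v_le μ F.o)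
  have hm0 : 0 ≤ ‖F.v μ F.o‖ ^ 2 := sq_nonneg _
  have hΔ := F.Δo_le_4dκ
  have hΔ0 := F.Δo_pos.le
  have hκ := F.κ_pos.le
  have hd : (0 : ℝ) ≤ d := Nat.cast_nonneg d
  have hdk : 0 ≤ 4 * (d : ℝ) * F.κ := by positivity
  have hprod : ‖F.v μ F.o‖ ^ 2 * F.Δ F.o * F.S₂ ≤ 1 * (4 * d * F.κ) * (1 / 16) :=
    mul_le_mul (mul_le_mul hm hΔ hΔ0 zero_le_one) hS₂ hS₂0 (by rw [one_mul]; exact hdk)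
  have hprod0 : 0 ≤ ‖F.v μ F.o‖ ^ 2 * F.Δ F.o * F.S₂ := mul_nonneg (mul_nonneg hm0 hΔ0) hS₂0
  have h1 : F.a * F.S₁ μ ≤ F.a * (1 / 4) := mul_le_mul_of_nonneg_left hS₁ ha
  have h2 : F.a * (‖F.v μ F.o‖ ^ 2 * F.Δ F.o * F.S₂) ≤ F.a * (1 * (4 * d * F.κ) * (1 / 16)) :=
    mul_le_mul_of_nonneg_left hprod ha
  have h3 : 0 ≤ F.a * (‖F.v μ F.o‖ ^ 2 * F.Δ F.o * F.S₂) := mul_nonneg ha hprod0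
  have h4 : 0 ≤ F.a * F.S₁ μ := mul_nonneg ha hS₁0
  have h5 : 0 ≤ F.a * (d * F.κ) := mul_nonneg ha (mul_nonneg hd hκ)
  rw [Br, Bconst, abs_le]
  constructor
  · nlinarith
  · nlinarith

/-! ### D.5 The decomposition `D_{w₁} G D_{w₂}^* = diagonal + 3 block-rank-one + rank-one` -/

/-- The algebra of (1.87): `D_{w₁} G(p′) D_{w₂}^*` decomposed; the `(0, μ)` diagonal entry
uses the `l′ = l` cancellation `O00`. [cite: Balaban1984PropagatorsI, (1.87)–(1.88) p.32] -/
theorem sandwich_G_eq (w₁ w₂ : Λ → ℂ) :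
    sandwich w₁ w₂ F.G
      = Matrix.diagonal (F.dg w₁ w₂) + blockR F.cR (F.xw w₁) (F.xw w₂)
        + blockR F.cR (F.xo w₁) (F.xw w₂) + blockR F.cR (F.xw w₁) (F.xo w₂)
        + rankOne F.cT (F.bw w₁) (F.bw w₂) := by
  ext ⟨l, μ⟩ ⟨l', ν⟩
  by_cases hμ : μ = ν
  · subst hμ
    by_cases hl : l = F.o
    · subst hl
      by_cases hl' : l' = F.o
      · subst hl'
        have key := F.O00 μ
        simp only [sandwich, G, Matrix.add_apply, Matrix.diagonal_apply, blockR, rankOne, dg, cR,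
          xw, xo, bw, if_true, map_mul, map_zero, mul_zero, zero_mul, add_zero]
        linear_combination (w₁ F.o * conj (w₂ F.o)) * key
      · simp only [sandwich, G, Matrix.add_apply, Matrix.diagonal_apply, blockR, rankOne, dg, cR,
          xw, xo, bw, Prod.mk.injEq, and_true, if_true, hl', Ne.symm hl',
          if_false, map_mul, map_zero, mul_zero, zero_mul, add_zero, zero_add, zero_sub]
        ring
    · by_cases hl' : l' = F.o
      · subst hl'
        simp only [sandwich, G, Matrix.add_apply, Matrix.diagonal_apply, blockR, rankOne, dg, cR,
          xw, xo, bw, Prod.mk.injEq, and_true, if_true, hl, if_false, map_mul,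
          map_zero, mul_zero, add_zero, zero_add, zero_sub]
        ring
      · by_cases hll : l = l'
        · subst hll
          simp only [sandwich, G, Matrix.add_apply, Matrix.diagonal_apply, blockR, rankOne, dg,
            cR, xw, xo, bw, if_true, hl, if_false, map_mul, map_zero, mul_zero, zero_mul,
            add_zero]
          ring
        · simp only [sandwich, G, Matrix.add_apply, Matrix.diagonal_apply, blockR, rankOne, dg,
            cR, xw, xo, bw, Prod.mk.injEq, and_true, if_true, hl, hl', hll,
            if_false, map_mul, map_zero, mul_zero, zero_mul, add_zero, zero_add,
            zero_sub]
          ring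
  · simp only [sandwich, G, Matrix.add_apply, Matrix.diagonal_apply, blockR, rankOne, dg, cR, xw,
      xo, bw, Prod.mk.injEq, hμ, and_false, if_false, map_mul, add_zero, zero_add]
    ring

/-! ### D.6 Weights -/

/-- Admissible pairs of diagonal weights: `|w_i(l)|, |w₁(l) w₂(l)| ≤ Δ(p′+l)` for `l ≠ 0`
and `≤ max(1, Δ(p′))` at `l = 0`. [folklore] -/
structure Wt (F : Fiber Λ d) (w₁ w₂ : Λ → ℂ) : Prop where
  left_le : ∀ l, l ≠ F.o → ‖w₁ l‖ ≤ F.Δ l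
  right_le : ∀ l, l ≠ F.o → ‖w₂ l‖ ≤ F.Δ l
  prod_le : ∀ l, l ≠ F.o → ‖w₁ l‖ * ‖w₂ l‖ ≤ F.Δ l
  left_o : ‖w₁ F.o‖ ≤ F.M
  right_o : ‖w₂ F.o‖ ≤ F.M
  prod_o : ‖w₁ F.o‖ * ‖w₂ F.o‖ ≤ F.M

/-- `t² ≤ T^j`, `j ≤ 2`, `T ≥ 1`, `t ≥ 0` give `t ≤ T`. [folklore] -/
lemma le_of_sq_le_pow {t T : ℝ} {j : ℕ} (ht : 0 ≤ t) (hT : 1 ≤ T) (hj : j ≤ 2)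
    (h : t ^ 2 ≤ T ^ j) : t ≤ T := by
  have h2 : t ^ 2 ≤ T ^ 2 := h.trans (pow_le_pow_right₀ hT hj)
  exact (pow_le_pow_iff_left₀ ht (by linarith) two_ne_zero).mp h2

/-- Weights of derivative orders `j₁, j₂` with `j₁ + j₂ ≤ 2` (`|w_i(l)|² ≤ Δ(p′+l)^{j_i}`,
e.g. `w = ∂_ν(p′+·)` has order 1, `∂_ν ∂_κ` order 2, `1` order 0) are admissible. [folklore] -/
lemma Wt_of_orders {w₁ w₂ : Λ → ℂ} {j₁ j₂ : ℕ} (hj : j₁ + j₂ ≤ 2)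
    (h₁ : ∀ l, ‖w₁ l‖ ^ 2 ≤ F.Δ l ^ j₁) (h₂ : ∀ l, ‖w₂ l‖ ^ 2 ≤ F.Δ l ^ j₂) : F.Wt w₁ w₂ where
  left_le l hl := le_of_sq_le_pow (norm_nonneg _) (F.one_le_Δ hl) (by omega) (h₁ l)
  right_le l hl := le_of_sq_le_pow (norm_nonneg _) (F.one_le_Δ hl) (by omega) (h₂ l)
  prod_le l hl := by
    refine le_of_sq_le_pow (j := j₁ + j₂) (mul_nonneg (norm_nonneg _) (norm_nonneg _))
      (F.one_le_Δ hl) hj ?_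
    rw [mul_pow, pow_add]
    exact mul_le_mul (h₁ l) (h₂ l) (sq_nonneg _) (pow_nonneg (F.Δ_pos l).le _)
  left_o := by
    refine le_of_sq_le_pow (j := j₁) (norm_nonneg _) F.one_le_M (by omega) ?_
    exact (h₁ F.o).trans (pow_le_pow_left₀ F.Δo_pos.le F.Δo_le_M j₁)
  right_o := by
    refine le_of_sq_le_pow (j := j₂) (norm_nonneg _) F.one_le_M (by omega) ?_
    exact (h₂ F.o).trans (pow_le_pow_left₀ F.Δo_pos.le F.Δo_le_M j₂)
  prod_o := by
    refine le_of_sq_le_pow (j := j₁ + j₂) (mul_nonneg (norm_nonneg _) (norm_nonneg _))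
      F.one_le_M hj ?_
    rw [mul_pow, pow_add]
    exact mul_le_mul ((h₁ F.o).trans (pow_le_pow_left₀ F.Δo_pos.le F.Δo_le_M j₁))
      ((h₂ F.o).trans (pow_le_pow_left₀ F.Δo_pos.le F.Δo_le_M j₂)) (sq_nonneg _)
      (pow_nonneg F.M_pos.le _)

/-- the trivial weights `w₁ = w₂ = 1` are admissible. [folklore] -/
lemma Wt_one : F.Wt (fun _ => (1 : ℂ)) (fun _ => (1 : ℂ)) where
  left_le l hl := by rw [norm_one]; exact F.one_le_Δ hl
  right_le l hl := by rw [norm_one]; exact F.one_le_Δ hl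
  prod_le l hl := by rw [norm_one, one_mul]; exact F.one_le_Δ hl
  left_o := by rw [norm_one]; exact F.one_le_M
  right_o := by rw [norm_one]; exact F.one_le_M
  prod_o := by rw [norm_one, one_mul]; exact F.one_le_M

/-! ### D.7 Bounds for the five pieces -/

/-- `K₀₀ ≥ 1`. [folklore] -/
lemma one_le_K00 : 1 ≤ K00 F.a F.cuv :=
  one_le_mul_of_one_le_of_one_le (by linarith [F.a_pos]) (le_max_right _ _)

/-- `K₀₀ ≥ 0`. [folklore] -/
lemma K00_nonneg : 0 ≤ K00 F.a F.cuv := le_trans zero_le_one F.one_le_K00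

/-- `max(1, Δ(p′)) ≤ max((a c_uv)⁻¹, 1) · (Δ(p′) + a c_uv)`. [folklore] -/
lemma M_le_K : F.M ≤ max (1 / (F.a * F.cuv)) 1 * (F.Δ F.o + F.a * F.cuv) := by
  have hac : 0 < F.a * F.cuv := mul_pos F.a_pos F.cuv_pos
  have hΔ := F.Δo_pos
  have hsum : 0 ≤ F.Δ F.o + F.a * F.cuv := by linarith
  apply max_le
  · calc (1 : ℝ) = 1 / (F.a * F.cuv) * (F.a * F.cuv) := (one_div_mul_cancel hac.ne').symm
      _ ≤ 1 / (F.a * F.cuv) * (F.Δ F.o + F.a * F.cuv) :=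
          mul_le_mul_of_nonneg_left (by linarith) (le_of_lt (one_div_pos.mpr hac))
      _ ≤ max (1 / (F.a * F.cuv)) 1 * (F.Δ F.o + F.a * F.cuv) :=
          mul_le_mul_of_nonneg_right (le_max_left _ _) hsum
  · calc F.Δ F.o ≤ 1 * (F.Δ F.o + F.a * F.cuv) := by linarith
      _ ≤ max (1 / (F.a * F.cuv)) 1 * (F.Δ F.o + F.a * F.cuv) :=
          mul_le_mul_of_nonneg_right (le_max_right _ _) hsum

/-- piece 1 (diagonal): every entry is `≤ K₀₀`. [folklore] -/
lemma norm_dg_le {w₁ w₂ : Λ → ℂ} (hw : F.Wt w₁ w₂) (i : Λ × Fin d) :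
    ‖F.dg w₁ w₂ i‖ ≤ K00 F.a F.cuv := by
  obtain ⟨l, μ⟩ := i
  by_cases hl : l = F.o
  · subst hl
    have hφ := F.φ_pos μ
    have hΔ := F.Δo_pos
    have hpos : 0 < F.φ μ * F.Δ F.o := mul_pos hφ hΔ
    have hnum : 0 ≤ 1 + F.a * F.S₁ μ := by nlinarith [F.a_pos, F.S₁_nonneg μ]
    have hcoef : ‖(1 + (F.a : ℂ) * (F.S₁ μ : ℂ)) / ((F.φ μ : ℂ) * (F.Δ F.o : ℂ))‖
        = (1 + F.a * F.S₁ μ) / (F.φ μ * F.Δ F.o) := by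
      have : (1 + (F.a : ℂ) * (F.S₁ μ : ℂ)) / ((F.φ μ : ℂ) * (F.Δ F.o : ℂ))
          = (((1 + F.a * F.S₁ μ) / (F.φ μ * F.Δ F.o) : ℝ) : ℂ) := by push_cast; ring
      rw [this, Complex.norm_of_nonneg (div_nonneg hnum hpos.le)]
    simp only [dg, if_true]
    rw [norm_mul, norm_mul, Complex.norm_conj, hcoef]
    have hww : ‖w₁ F.o‖ * ‖w₂ F.o‖ ≤ F.M := hw.prod_o
    have hM := F.M_le_K
    have hS : 1 + F.a * F.S₁ μ ≤ 1 + F.a / 4 := by nlinarith [F.S₁_le μ, F.a_pos]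
    have hφΔ : F.Δ F.o + F.a * F.cuv ≤ F.φ μ * F.Δ F.o := F.Δo_acuv_le_φΔo μ
    have hmax0 : 0 ≤ max (1 / (F.a * F.cuv)) 1 := le_trans zero_le_one (le_max_right _ _)
    have hsum0 : 0 ≤ F.Δ F.o + F.a * F.cuv := by nlinarith [F.a_pos, F.cuv_pos]
    have ha4 : 0 ≤ 1 + F.a / 4 := by nlinarith [F.a_pos]
    calc ‖w₁ F.o‖ * ‖w₂ F.o‖ * ((1 + F.a * F.S₁ μ) / (F.φ μ * F.Δ F.o))
        ≤ (max (1 / (F.a * F.cuv)) 1 * (F.Δ F.o + F.a * F.cuv))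
            * ((1 + F.a / 4) / (F.φ μ * F.Δ F.o)) :=
          mul_le_mul (hww.trans hM) (div_le_div_of_nonneg_right hS hpos.le)
            (div_nonneg hnum hpos.le) (mul_nonneg hmax0 hsum0)
      _ = max (1 / (F.a * F.cuv)) 1 * (1 + F.a / 4)
            * ((F.Δ F.o + F.a * F.cuv) / (F.φ μ * F.Δ F.o)) := by ring
      _ ≤ max (1 / (F.a * F.cuv)) 1 * (1 + F.a / 4) * 1 :=
          mul_le_mul_of_nonneg_left ((div_le_one hpos).mpr hφΔ) (mul_nonneg hmax0 ha4)
      _ = K00 F.a F.cuv := by rw [K00]; ring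
  · simp only [dg, hl, if_false]
    rw [norm_mul, norm_mul, Complex.norm_conj, norm_div, norm_one,
      Complex.norm_of_nonneg (F.Δ_pos l).le]
    have h1 : ‖w₁ l‖ * ‖w₂ l‖ * (1 / F.Δ l) ≤ 1 := by
      rw [mul_one_div, div_le_one (F.Δ_pos l)]
      exact hw.prod_le l hl
    exact h1.trans F.one_le_K00

/-- `|−a φ_μ⁻¹| = a/φ_μ`. [folklore] -/
lemma norm_cR (μ : Fin d) : ‖F.cR μ‖ = F.a / F.φ μ := by
  rw [cR, norm_neg, norm_div, Complex.norm_of_nonneg F.a_pos.le,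
    Complex.norm_of_nonneg (F.φ_pos μ).le]

/-- `Σ_{l ≠ 0} |w(l) x_μ(l)|² ≤ S₀ ≤ 1` when `|w(l)| ≤ Δ(p′+l)` for `l ≠ 0`. [folklore] -/
lemma sum_xw_sq_le {w : Λ → ℂ} (hwl : ∀ l, l ≠ F.o → ‖w l‖ ≤ F.Δ l) (μ : Fin d) :
    ∑ l, ‖F.xw w μ l‖ ^ 2 ≤ 1 := by
  have h0 : (fun l => ‖F.xw w μ l‖ ^ 2) F.o = 0 := by simp [xw]
  rw [← Finset.sum_erase (f := fun l => ‖F.xw w μ l‖ ^ 2) univ h0]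
  calc ∑ l ∈ univ.erase F.o, ‖F.xw w μ l‖ ^ 2 ≤ ∑ l ∈ univ.erase F.o, ‖F.u l‖ ^ 2 := by
        refine Finset.sum_le_sum fun l hl => ?_
        have hl' : l ≠ F.o := (Finset.mem_erase.mp hl).1
        have hΔ := F.Δ_pos l
        simp only [xw, hl', if_false]
        rw [norm_mul, F.norm_x]
        have h1 : ‖w l‖ * (‖F.u l * F.v μ l‖ / F.Δ l) ≤ ‖F.u l‖ := by
          rw [mul_div_assoc', div_le_iff₀ hΔ]
          calc ‖w l‖ * ‖F.u l * F.v μ l‖ ≤ F.Δ l * ‖F.u l‖ :=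
                mul_le_mul (hwl l hl') (F.norm_uv_le μ l) (norm_nonneg _) hΔ.le
            _ = ‖F.u l‖ * F.Δ l := mul_comm _ _
        exact pow_le_pow_left₀ (mul_nonneg (norm_nonneg _) (div_nonneg (norm_nonneg _) hΔ.le)) h1 2
    _ = F.S₀ := rfl
    _ ≤ 1 := F.S₀_le_one

/-- `|(w x_μ)′|₂ ≤ 1` when `|w(l)| ≤ Δ(p′+l)` for `l ≠ 0`. [folklore] -/
lemma l2n_xw_le_one {w : Λ → ℂ} (hwl : ∀ l, l ≠ F.o → ‖w l‖ ≤ F.Δ l) (μ : Fin d) :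
    l2n (F.xw w μ) ≤ 1 :=
  l2n_le_of_sq_le zero_le_one (by rw [one_pow]; exact F.sum_xw_sq_le hwl μ)

/-- `|(w x_μ)⁰|₂ = |w(0)| · |u v_μ|(p′)/Δ(p′)`. [folklore] -/
lemma l2n_xo (w : Λ → ℂ) (μ : Fin d) :
    l2n (F.xo w μ) = ‖w F.o‖ * (‖F.u F.o * F.v μ F.o‖ / F.Δ F.o) := by
  have h0 : 0 ≤ ‖w F.o‖ * (‖F.u F.o * F.v μ F.o‖ / F.Δ F.o) :=
    mul_nonneg (norm_nonneg _) (div_nonneg (norm_nonneg _) F.Δo_pos.le)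
  have hsum : ∑ l, ‖F.xo w μ l‖ ^ 2 = (‖w F.o‖ * (‖F.u F.o * F.v μ F.o‖ / F.Δ F.o)) ^ 2 := by
    have h : ∀ l, ‖F.xo w μ l‖ ^ 2
        = if l = F.o then (‖w F.o‖ * (‖F.u F.o * F.v μ F.o‖ / F.Δ F.o)) ^ 2 else 0 := by
      intro l
      by_cases hl : l = F.o
      · simp only [xo, hl, if_true, norm_mul, F.norm_x]
      · simp [xo, hl]
    rw [Finset.sum_congr rfl fun l _ => h l, Finset.sum_ite_eq' univ F.o, if_pos (Finset.mem_univ _)]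
  rw [l2n, hsum, Real.sqrt_sq h0]

/-- the heart of the cross-term bound: `a φ_μ⁻¹ · t |u v_μ|(p′)/Δ(p′) ≤ c_uv⁻¹ + a` for
`t ≤ max(1, Δ(p′))`. [folklore] -/
lemma cross_core (μ : Fin d) {t : ℝ} (ht : t ≤ F.M) :
    F.a / F.φ μ * (t * (‖F.u F.o * F.v μ F.o‖ / F.Δ F.o)) ≤ F1 F.a F.cuv := by
  set n := ‖F.u F.o * F.v μ F.o‖ with hn
  have hn1 : n ≤ 1 := F.norm_uvo_le_one μ
  have hn0 : 0 ≤ n := norm_nonneg _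
  have hcuv : F.cuv ≤ n ^ 2 := F.cuv_le μ
  have hφΔ : F.Δ F.o + F.a * n ^ 2 ≤ F.φ μ * F.Δ F.o := F.φΔo_ge μ
  have hM := F.M_le'
  have hφ1 := F.one_le_φ μ
  have hφ := F.φ_pos μ
  have ha := F.a_pos
  have hΔ := F.Δo_pos
  have hc := F.cuv_pos
  have hφ' : F.φ μ ≠ 0 := hφ.ne'
  have hΔ' : F.Δ F.o ≠ 0 := hΔ.ne'
  have ha' : F.a ≠ 0 := ha.ne'
  have hc' : F.cuv ≠ 0 := hc.ne'
  have hpos : 0 < F.φ μ * F.Δ F.o := mul_pos hφ hΔ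
  have e1 : F.a / F.φ μ * (t * (n / F.Δ F.o)) = F.a * t * n / (F.φ μ * F.Δ F.o) := by
    field_simp
  have s1 : F.a * t * n / (F.φ μ * F.Δ F.o) ≤ F.a * (1 + F.Δ F.o) * n / (F.φ μ * F.Δ F.o) := by
    apply div_le_div_of_nonneg_right _ hpos.le
    have h1 : F.a * t ≤ F.a * (1 + F.Δ F.o) := mul_le_mul_of_nonneg_left (ht.trans hM) ha.le
    exact mul_le_mul_of_nonneg_right h1 hn0
  have e2 : F.a * (1 + F.Δ F.o) * n / (F.φ μ * F.Δ F.o)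
      = F.a * n / (F.φ μ * F.Δ F.o) + F.a * n / F.φ μ := by
    field_simp
  have s2 : F.a * n / (F.φ μ * F.Δ F.o) ≤ 1 / F.cuv := by
    rw [div_le_div_iff₀ hpos hc]
    have h1 : n * F.cuv ≤ n * n ^ 2 := mul_le_mul_of_nonneg_left hcuv hn0
    have h2 : n * n ^ 2 ≤ n ^ 2 := by nlinarith [sq_nonneg n]
    have h3 : F.a * (n * F.cuv) ≤ F.a * n ^ 2 := mul_le_mul_of_nonneg_left (h1.trans h2) ha.le
    nlinarith
  have s3 : F.a * n / F.φ μ ≤ F.a := by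
    rw [div_le_iff₀ hφ]
    nlinarith
  rw [e1, F1]
  calc F.a * t * n / (F.φ μ * F.Δ F.o) ≤ F.a * (1 + F.Δ F.o) * n / (F.φ μ * F.Δ F.o) := s1
    _ = F.a * n / (F.φ μ * F.Δ F.o) + F.a * n / F.φ μ := e2
    _ ≤ 1 / F.cuv + F.a := add_le_add s2 s3

/-- `F₁ ≥ 0`. [folklore] -/
lemma F1_nonneg : 0 ≤ F1 F.a F.cuv :=
  add_nonneg (div_nonneg zero_le_one F.cuv_pos.le) F.a_pos.le

/-- piece 2: `|blockR (−aφ⁻¹) (w₁x)′ (w₂x)′| ≤ a`. [folklore] -/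
lemma piece_R_le {w₁ w₂ : Λ → ℂ} (hw : F.Wt w₁ w₂) :
    ‖blockR F.cR (F.xw w₁) (F.xw w₂)‖ ≤ F.a := by
  refine opNorm_blockR_le _ _ _ F.a_pos.le fun μ => ?_
  rw [norm_cR]
  have h1 := F.l2n_xw_le_one hw.left_le μ
  have h2 := F.l2n_xw_le_one hw.right_le μ
  have h12 : l2n (F.xw w₁ μ) * l2n (F.xw w₂ μ) ≤ 1 := mul_le_one₀ h1 (l2n_nonneg _) h2
  have hφ1 := F.one_le_φ μ
  have hφ := F.φ_pos μ
  have ha := F.a_pos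
  calc F.a / F.φ μ * (l2n (F.xw w₁ μ) * l2n (F.xw w₂ μ)) ≤ F.a / F.φ μ * 1 :=
        mul_le_mul_of_nonneg_left h12 (div_nonneg ha.le hφ.le)
    _ ≤ F.a := by
        rw [mul_one, div_le_iff₀ hφ]
        nlinarith

/-- piece 3: `|blockR (−aφ⁻¹) (w₁x)⁰ (w₂x)′| ≤ F₁`. [folklore] -/
lemma piece_C1_le {w₁ w₂ : Λ → ℂ} (hw : F.Wt w₁ w₂) :
    ‖blockR F.cR (F.xo w₁) (F.xw w₂)‖ ≤ F1 F.a F.cuv := by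
  refine opNorm_blockR_le _ _ _ F.F1_nonneg fun μ => ?_
  rw [norm_cR, l2n_xo]
  have h2 := F.l2n_xw_le_one hw.right_le μ
  have h0 : 0 ≤ ‖w₁ F.o‖ * (‖F.u F.o * F.v μ F.o‖ / F.Δ F.o) :=
    mul_nonneg (norm_nonneg _) (div_nonneg (norm_nonneg _) F.Δo_pos.le)
  have hc0 : 0 ≤ F.a / F.φ μ := div_nonneg F.a_pos.le (F.φ_pos μ).le
  calc F.a / F.φ μ * (‖w₁ F.o‖ * (‖F.u F.o * F.v μ F.o‖ / F.Δ F.o) * l2n (F.xw w₂ μ))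
      ≤ F.a / F.φ μ * (‖w₁ F.o‖ * (‖F.u F.o * F.v μ F.o‖ / F.Δ F.o) * 1) :=
        mul_le_mul_of_nonneg_left (mul_le_mul_of_nonneg_left h2 h0) hc0
    _ = F.a / F.φ μ * (‖w₁ F.o‖ * (‖F.u F.o * F.v μ F.o‖ / F.Δ F.o)) := by rw [mul_one]
    _ ≤ F1 F.a F.cuv := F.cross_core μ hw.left_o

/-- piece 4: `|blockR (−aφ⁻¹) (w₁x)′ (w₂x)⁰| ≤ F₁`. [folklore] -/
lemma piece_C2_le {w₁ w₂ : Λ → ℂ} (hw : F.Wt w₁ w₂) :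
    ‖blockR F.cR (F.xw w₁) (F.xo w₂)‖ ≤ F1 F.a F.cuv := by
  refine opNorm_blockR_le _ _ _ F.F1_nonneg fun μ => ?_
  rw [norm_cR, l2n_xo]
  have h1 := F.l2n_xw_le_one hw.left_le μ
  have h0 : 0 ≤ ‖w₂ F.o‖ * (‖F.u F.o * F.v μ F.o‖ / F.Δ F.o) :=
    mul_nonneg (norm_nonneg _) (div_nonneg (norm_nonneg _) F.Δo_pos.le)
  have hc0 : 0 ≤ F.a / F.φ μ := div_nonneg F.a_pos.le (F.φ_pos μ).le
  calc F.a / F.φ μ * (l2n (F.xw w₁ μ) * (‖w₂ F.o‖ * (‖F.u F.o * F.v μ F.o‖ / F.Δ F.o)))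
      ≤ F.a / F.φ μ * (1 * (‖w₂ F.o‖ * (‖F.u F.o * F.v μ F.o‖ / F.Δ F.o))) :=
        mul_le_mul_of_nonneg_left (mul_le_mul_of_nonneg_right h1 h0) hc0
    _ = F.a / F.φ μ * (‖w₂ F.o‖ * (‖F.u F.o * F.v μ F.o‖ / F.Δ F.o)) := by rw [one_mul]
    _ ≤ F1 F.a F.cuv := F.cross_core μ hw.right_o

/-- `|w(0)| |b(0, μ)| ≤ C₀ Δ₀(p′)` — the extra factor `Δ₀` at `l = 0` comes from (1.88).
[folklore] -/
lemma wb_o_le {w : Λ → ℂ} (hwo : ‖w F.o‖ ≤ F.M) (μ : Fin d) :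
    ‖w F.o‖ * ‖F.b F.o μ‖ ≤ C0 d F.a F.cu F.cuv F.κ * F.Δ₀ := by
  have hΔ := F.Δo_pos
  have hX := F.X_pos
  have hφ := F.φ_pos μ
  have ha := F.a_pos
  have hcu := F.cu_pos
  have hcuv := F.cuv_pos
  have hκ := F.κ_pos
  have hΔ' : F.Δ F.o ≠ 0 := hΔ.ne'
  have hX' : F.X ≠ 0 := hX.ne'
  have hφ' : F.φ μ ≠ 0 := hφ.ne'
  have ha' : F.a ≠ 0 := ha.ne'
  have hcu' : F.cu ≠ 0 := hcu.ne'
  have hcuv' : F.cuv ≠ 0 := hcuv.ne'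
  have hden : 0 < F.Δ F.o ^ 2 * F.X * F.φ μ := mul_pos (mul_pos (pow_pos hΔ 2) hX) hφ
  rw [norm_b_o, r_eq, abs_div, abs_of_pos hden]
  have hd : (0 : ℝ) ≤ d := Nat.cast_nonneg d
  have hA0 : 0 ≤ 1 + 4 * (d : ℝ) * F.κ := by nlinarith [hκ.le]
  have t1 : ‖w F.o‖ * ‖F.e μ F.o‖ ≤ (1 + 4 * d * F.κ) ^ 2 := by
    calc ‖w F.o‖ * ‖F.e μ F.o‖ ≤ (1 + 4 * d * F.κ) * (1 + 4 * d * F.κ) :=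
          mul_le_mul (hwo.trans F.M_le) (F.norm_e_o_le μ) (norm_nonneg _) hA0
      _ = (1 + 4 * d * F.κ) ^ 2 := by ring
  have t2 : ‖F.u F.o‖ / (F.Δ F.o ^ 2 * F.X) ≤ 1 / F.cu := by
    have hXu : ‖F.u F.o‖ ^ 2 ≤ F.X * F.Δ F.o ^ 2 := by
      have := F.uo_term_le_X
      rwa [div_le_iff₀ (pow_pos hΔ 2)] at this
    rw [div_le_div_iff₀ (mul_pos (pow_pos hΔ 2) hX) hcu]
    have hu1 := F.norm_u_le F.o
    have hu0 := norm_nonneg (F.u F.o)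
    have hcule := F.cu_le
    have h3 : ‖F.u F.o‖ * F.cu ≤ ‖F.u F.o‖ * ‖F.u F.o‖ ^ 2 := mul_le_mul_of_nonneg_left hcule hu0
    nlinarith
  have t3 : |F.Br μ| ≤ Bconst d F.a F.κ := F.abs_Br_le μ
  have t4 : 1 / F.φ μ ≤ F.κ * F.Δ₀ / (F.a * F.cuv) := F.inv_φ_le μ
  have e : ‖w F.o‖ * (‖F.e μ F.o‖ * ‖F.u F.o‖ * (|F.Br μ| / (F.Δ F.o ^ 2 * F.X * F.φ μ)))
      = (‖w F.o‖ * ‖F.e μ F.o‖) * (‖F.u F.o‖ / (F.Δ F.o ^ 2 * F.X)) * |F.Br μ| * (1 / F.φ μ) := by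
    field_simp
  rw [e]
  have n2 : 0 ≤ ‖F.u F.o‖ / (F.Δ F.o ^ 2 * F.X) :=
    div_nonneg (norm_nonneg _) (mul_pos (pow_pos hΔ 2) hX).le
  have nB := F.Bconst_nonneg
  have ncu : 0 ≤ 1 / F.cu := div_nonneg zero_le_one hcu.le
  calc (‖w F.o‖ * ‖F.e μ F.o‖) * (‖F.u F.o‖ / (F.Δ F.o ^ 2 * F.X)) * |F.Br μ| * (1 / F.φ μ)
      ≤ (1 + 4 * d * F.κ) ^ 2 * (1 / F.cu) * Bconst d F.a F.κ * (F.κ * F.Δ₀ / (F.a * F.cuv)) := by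
        apply mul_le_mul _ t4 (div_nonneg zero_le_one hφ.le)
          (mul_nonneg (mul_nonneg (sq_nonneg _) ncu) nB)
        apply mul_le_mul _ t3 (abs_nonneg _) (mul_nonneg (sq_nonneg _) ncu)
        exact mul_le_mul t1 t2 n2 (sq_nonneg _)
    _ = C0 d F.a F.cu F.cuv F.κ * F.Δ₀ := by
        rw [C0]
        ring

/-- `C_l ≥ 0`. [folklore] -/
lemma Cl_nonneg : 0 ≤ Cl d F.cu F.cuv F.κ := by
  have hd : (0 : ℝ) ≤ d := Nat.cast_nonneg d
  have hκ := F.κ_pos.le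
  rw [Cl]
  exact add_nonneg (div_nonneg (by positivity) F.cu_pos.le) (div_nonneg (by positivity) F.cuv_pos.le)

/-- `|w(l)| |b(l, μ)| ≤ |u(p′+l)| C_l Δ₀(p′)` for `l ≠ 0`. [folklore] -/
lemma wb_l_le {w : Λ → ℂ} (hwl : ∀ l, l ≠ F.o → ‖w l‖ ≤ F.Δ l) (l : Λ) (hl : l ≠ F.o)
    (μ : Fin d) : ‖w l‖ * ‖F.b l μ‖ ≤ ‖F.u l‖ * (Cl d F.cu F.cuv F.κ * F.Δ₀) := by
  have hΔ := F.Δ_pos l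
  have hX := F.X_pos
  have hφ := F.φ_pos μ
  have ha := F.a_pos
  have hcu := F.cu_pos
  have hcuv := F.cuv_pos
  have hΔ' : F.Δ l ≠ 0 := hΔ.ne'
  have hX' : F.X ≠ 0 := hX.ne'
  have hφ' : F.φ μ ≠ 0 := hφ.ne'
  have ha' : F.a ≠ 0 := ha.ne'
  have hcu' : F.cu ≠ 0 := hcu.ne'
  have hcuv' : F.cuv ≠ 0 := hcuv.ne'
  have hd : (0 : ℝ) ≤ d := Nat.cast_nonneg d
  have hwl' := hwl l hl
  have he := F.norm_e_le_half hl μ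
  have huv := F.norm_uv_le μ l
  have he₁ := F.norm_e₁_le μ
  -- the two terms of `b`
  have hb : ‖F.b l μ‖ ≤ ‖F.e μ l‖ * ‖F.u l‖ / (F.Δ l ^ 2 * F.X)
      + F.a * ‖F.u l * F.v μ l‖ * ‖F.e₁ μ‖ / (F.φ μ * F.Δ l) := by
    rw [b]
    refine (norm_sub_le _ _).trans (le_of_eq ?_)
    simp only [norm_div, norm_mul, norm_pow, Complex.norm_conj, Complex.norm_of_nonneg hΔ.le,
      Complex.norm_of_nonneg hX.le, Complex.norm_of_nonneg ha.le, Complex.norm_of_nonneg hφ.le]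
  -- term 1
  have hXi : 1 / F.X ≤ F.Δ F.o ^ 2 / F.cu := F.inv_X_le
  have hΔo : F.Δ F.o ^ 2 ≤ F.κ ^ 2 * F.Δ₀ ^ 2 := by
    rw [← mul_pow]
    exact pow_le_pow_left₀ F.Δo_pos.le F.Δo_le' 2
  have hΔ₀ : F.Δ₀ ^ 2 ≤ 4 * d * F.Δ₀ := by
    have := F.Δ₀_le
    have h0 := F.Δ₀_pos'.le
    nlinarith
  have term1 : ‖w l‖ * (‖F.e μ l‖ * ‖F.u l‖ / (F.Δ l ^ 2 * F.X))
      ≤ ‖F.u l‖ * (2 * d * F.κ ^ 2 / F.cu * F.Δ₀) := by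
    have s1 : ‖w l‖ * (‖F.e μ l‖ * ‖F.u l‖ / (F.Δ l ^ 2 * F.X))
        ≤ F.Δ l * (F.Δ l / 2 * ‖F.u l‖ / (F.Δ l ^ 2 * F.X)) := by
      apply mul_le_mul hwl' _ (div_nonneg (mul_nonneg (norm_nonneg _) (norm_nonneg _))
        (mul_pos (pow_pos hΔ 2) hX).le) hΔ.le
      apply div_le_div_of_nonneg_right _ (mul_pos (pow_pos hΔ 2) hX).le
      exact mul_le_mul_of_nonneg_right he (norm_nonneg _)
    have s2 : F.Δ l * (F.Δ l / 2 * ‖F.u l‖ / (F.Δ l ^ 2 * F.X)) = ‖F.u l‖ / 2 * (1 / F.X) := by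
      field_simp
    have s3 : ‖F.u l‖ / 2 * (1 / F.X) ≤ ‖F.u l‖ / 2 * (F.κ ^ 2 * (4 * d * F.Δ₀) / F.cu) := by
      apply mul_le_mul_of_nonneg_left _ (by positivity)
      calc 1 / F.X ≤ F.Δ F.o ^ 2 / F.cu := hXi
        _ ≤ F.κ ^ 2 * F.Δ₀ ^ 2 / F.cu := div_le_div_of_nonneg_right hΔo hcu.le
        _ ≤ F.κ ^ 2 * (4 * d * F.Δ₀) / F.cu :=
            div_le_div_of_nonneg_right (mul_le_mul_of_nonneg_left hΔ₀ (sq_nonneg _)) hcu.le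
    calc ‖w l‖ * (‖F.e μ l‖ * ‖F.u l‖ / (F.Δ l ^ 2 * F.X))
        ≤ F.Δ l * (F.Δ l / 2 * ‖F.u l‖ / (F.Δ l ^ 2 * F.X)) := s1
      _ = ‖F.u l‖ / 2 * (1 / F.X) := s2
      _ ≤ ‖F.u l‖ / 2 * (F.κ ^ 2 * (4 * d * F.Δ₀) / F.cu) := s3
      _ = ‖F.u l‖ * (2 * d * F.κ ^ 2 / F.cu * F.Δ₀) := by
          field_simp
          ring
  -- term 2
  have hφi : 1 / F.φ μ ≤ F.κ * F.Δ₀ / (F.a * F.cuv) := F.inv_φ_le μ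
  have term2 : ‖w l‖ * (F.a * ‖F.u l * F.v μ l‖ * ‖F.e₁ μ‖ / (F.φ μ * F.Δ l))
      ≤ ‖F.u l‖ * (2 * F.κ / F.cuv * F.Δ₀) := by
    have s1 : ‖w l‖ * (F.a * ‖F.u l * F.v μ l‖ * ‖F.e₁ μ‖ / (F.φ μ * F.Δ l))
        ≤ F.Δ l * (F.a * ‖F.u l‖ * 2 / (F.φ μ * F.Δ l)) := by
      apply mul_le_mul hwl' _ (div_nonneg (mul_nonneg (mul_nonneg ha.le (norm_nonneg _))
        (norm_nonneg _)) (mul_pos hφ hΔ).le) hΔ.le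
      apply div_le_div_of_nonneg_right _ (mul_pos hφ hΔ).le
      exact mul_le_mul (mul_le_mul_of_nonneg_left huv ha.le) he₁ (norm_nonneg _)
        (mul_nonneg ha.le (norm_nonneg _))
    have s2 : F.Δ l * (F.a * ‖F.u l‖ * 2 / (F.φ μ * F.Δ l)) = 2 * F.a * ‖F.u l‖ * (1 / F.φ μ) := by
      field_simp
    have s3 : 2 * F.a * ‖F.u l‖ * (1 / F.φ μ) ≤ 2 * F.a * ‖F.u l‖ * (F.κ * F.Δ₀ / (F.a * F.cuv)) :=
      mul_le_mul_of_nonneg_left hφi (mul_nonneg (mul_nonneg zero_le_two ha.le) (norm_nonneg _))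
    calc ‖w l‖ * (F.a * ‖F.u l * F.v μ l‖ * ‖F.e₁ μ‖ / (F.φ μ * F.Δ l))
        ≤ F.Δ l * (F.a * ‖F.u l‖ * 2 / (F.φ μ * F.Δ l)) := s1
      _ = 2 * F.a * ‖F.u l‖ * (1 / F.φ μ) := s2
      _ ≤ 2 * F.a * ‖F.u l‖ * (F.κ * F.Δ₀ / (F.a * F.cuv)) := s3
      _ = ‖F.u l‖ * (2 * F.κ / F.cuv * F.Δ₀) := by
          field_simp
  calc ‖w l‖ * ‖F.b l μ‖
      ≤ ‖w l‖ * (‖F.e μ l‖ * ‖F.u l‖ / (F.Δ l ^ 2 * F.X)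
          + F.a * ‖F.u l * F.v μ l‖ * ‖F.e₁ μ‖ / (F.φ μ * F.Δ l)) :=
        mul_le_mul_of_nonneg_left hb (norm_nonneg _)
    _ = ‖w l‖ * (‖F.e μ l‖ * ‖F.u l‖ / (F.Δ l ^ 2 * F.X))
          + ‖w l‖ * (F.a * ‖F.u l * F.v μ l‖ * ‖F.e₁ μ‖ / (F.φ μ * F.Δ l)) := mul_add _ _ _
    _ ≤ ‖F.u l‖ * (2 * d * F.κ ^ 2 / F.cu * F.Δ₀) + ‖F.u l‖ * (2 * F.κ / F.cuv * F.Δ₀) :=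
        add_le_add term1 term2
    _ = ‖F.u l‖ * (Cl d F.cu F.cuv F.κ * F.Δ₀) := by
        rw [Cl]
        ring

/-- `Σ_{(l,μ)} |w(l) b(l,μ)|² ≤ C_b² Δ₀(p′)²` — the "additional factor Δ₀²(p′)" of p. 32.
[folklore] -/
lemma sum_bw_sq_le {w : Λ → ℂ} (hwl : ∀ l, l ≠ F.o → ‖w l‖ ≤ F.Δ l) (hwo : ‖w F.o‖ ≤ F.M) :
    ∑ i, ‖F.bw w i‖ ^ 2 ≤ Cb2 d F.a F.cu F.cuv F.κ * F.Δ₀ ^ 2 := by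
  have hd : (0 : ℝ) ≤ d := Nat.cast_nonneg d
  have hC0 : 0 ≤ C0 d F.a F.cu F.cuv F.κ * F.Δ₀ := by
    have h := F.wb_o_le hwo
    rcases isEmpty_or_nonempty (Fin d) with hd0 | ⟨⟨μ⟩⟩
    · -- with `Fin d` empty the fiber has `Δ₀ = 0`, contradicting `Δ₀_pos`
      exfalso
      have hz : F.Δ₀ = 0 := by
        rw [Δ₀_def]
        exact Finset.sum_eq_zero fun μ _ => (IsEmpty.false μ).elim
      exact absurd hz F.Δ₀_pos'.ne'
    · exact le_trans (mul_nonneg (norm_nonneg _) (norm_nonneg _)) (h μ)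
  have ho : ∑ μ, ‖F.bw w (F.o, μ)‖ ^ 2 ≤ d * (C0 d F.a F.cu F.cuv F.κ * F.Δ₀) ^ 2 := by
    calc ∑ μ, ‖F.bw w (F.o, μ)‖ ^ 2 ≤ ∑ _μ : Fin d, (C0 d F.a F.cu F.cuv F.κ * F.Δ₀) ^ 2 := by
          refine Finset.sum_le_sum fun μ _ => ?_
          simp only [bw]
          rw [norm_mul]
          exact pow_le_pow_left₀ (mul_nonneg (norm_nonneg _) (norm_nonneg _)) (F.wb_o_le hwo μ) 2
      _ = d * (C0 d F.a F.cu F.cuv F.κ * F.Δ₀) ^ 2 := by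
          simp only [Finset.sum_const, Finset.card_univ, Fintype.card_fin, nsmul_eq_mul]
  have hl : ∀ l ∈ univ.erase F.o,
      ∑ μ, ‖F.bw w (l, μ)‖ ^ 2 ≤ d * (Cl d F.cu F.cuv F.κ * F.Δ₀) ^ 2 * ‖F.u l‖ ^ 2 := by
    intro l hl
    have hl' : l ≠ F.o := (Finset.mem_erase.mp hl).1
    calc ∑ μ, ‖F.bw w (l, μ)‖ ^ 2 ≤ ∑ _μ : Fin d, (‖F.u l‖ * (Cl d F.cu F.cuv F.κ * F.Δ₀)) ^ 2 := by
          refine Finset.sum_le_sum fun μ _ => ?_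
          simp only [bw]
          rw [norm_mul]
          exact pow_le_pow_left₀ (mul_nonneg (norm_nonneg _) (norm_nonneg _))
            (F.wb_l_le hwl l hl' μ) 2
      _ = d * (Cl d F.cu F.cuv F.κ * F.Δ₀) ^ 2 * ‖F.u l‖ ^ 2 := by
          simp only [Finset.sum_const, Finset.card_univ, Fintype.card_fin, nsmul_eq_mul]
          ring
  rw [Fintype.sum_prod_type, ← Finset.add_sum_erase univ _ (Finset.mem_univ F.o)]
  calc (∑ μ, ‖F.bw w (F.o, μ)‖ ^ 2) + ∑ l ∈ univ.erase F.o, ∑ μ, ‖F.bw w (l, μ)‖ ^ 2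
      ≤ d * (C0 d F.a F.cu F.cuv F.κ * F.Δ₀) ^ 2
          + ∑ l ∈ univ.erase F.o, d * (Cl d F.cu F.cuv F.κ * F.Δ₀) ^ 2 * ‖F.u l‖ ^ 2 :=
        add_le_add ho (Finset.sum_le_sum hl)
    _ = d * (C0 d F.a F.cu F.cuv F.κ * F.Δ₀) ^ 2 + d * (Cl d F.cu F.cuv F.κ * F.Δ₀) ^ 2 * F.S₀ := by
        rw [S₀, Finset.mul_sum]
    _ ≤ d * (C0 d F.a F.cu F.cuv F.κ * F.Δ₀) ^ 2 + d * (Cl d F.cu F.cuv F.κ * F.Δ₀) ^ 2 * 1 :=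
        add_le_add le_rfl (mul_le_mul_of_nonneg_left F.S₀_le_one
          (mul_nonneg hd (sq_nonneg _)))
    _ = Cb2 d F.a F.cu F.cuv F.κ * F.Δ₀ ^ 2 := by
        rw [Cb2]
        ring

/-- `C_b² ≥ 0`. [folklore] -/
lemma Cb2_nonneg : 0 ≤ Cb2 d F.a F.cu F.cuv F.κ := by
  have hd : (0 : ℝ) ≤ d := Nat.cast_nonneg d
  rw [Cb2]
  exact mul_nonneg hd (add_nonneg (sq_nonneg _) (sq_nonneg _))

/-- `|a⁻¹ Φ⁻¹| = 1/(a Φ)`. [folklore] -/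
lemma norm_cT : ‖F.cT‖ = 1 / (F.a * F.Φ) := by
  rw [cT, norm_div, norm_one, norm_mul, Complex.norm_of_nonneg F.a_pos.le,
    Complex.norm_of_nonneg F.Φ_pos.le]

/-- piece 5 (third group of (1.83)): `|a⁻¹Φ⁻¹ (w₁b) ⊗ conj(w₂b)| ≤ γ₊ C_b² / a`. [folklore] -/
lemma piece_T_le {w₁ w₂ : Λ → ℂ} (hw : F.Wt w₁ w₂) :
    ‖rankOne F.cT (F.bw w₁) (F.bw w₂)‖ ≤ gammaPlus d F.a * Cb2 d F.a F.cu F.cuv F.κ / F.a := by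
  have ha := F.a_pos
  have ha' : F.a ≠ 0 := ha.ne'
  have hΔ₀ := F.Δ₀_pos'
  have hΔ₀' : F.Δ₀ ≠ 0 := hΔ₀.ne'
  have hγ := F.gammaPlus_pos
  have hCb := F.Cb2_nonneg
  refine opNorm_rankOne_le _ _ _ (div_nonneg (mul_nonneg hγ.le hCb) ha.le) ?_
  rw [norm_cT]
  have h1 := F.sum_bw_sq_le hw.left_le hw.left_o
  have h2 := F.sum_bw_sq_le hw.right_le hw.right_o
  have h12 : l2n (F.bw w₁) * l2n (F.bw w₂) ≤ Cb2 d F.a F.cu F.cuv F.κ * F.Δ₀ ^ 2 :=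
    l2n_mul_l2n_le h1 h2
  have hcT : 1 / (F.a * F.Φ) ≤ gammaPlus d F.a / (F.a * F.Δ₀ ^ 2) := F.cT_le
  calc 1 / (F.a * F.Φ) * (l2n (F.bw w₁) * l2n (F.bw w₂))
      ≤ gammaPlus d F.a / (F.a * F.Δ₀ ^ 2) * (Cb2 d F.a F.cu F.cuv F.κ * F.Δ₀ ^ 2) :=
        mul_le_mul hcT h12 (mul_nonneg (l2n_nonneg _) (l2n_nonneg _))
          (div_nonneg hγ.le (mul_pos ha (pow_pos hΔ₀ 2)).le)
    _ = gammaPlus d F.a * Cb2 d F.a F.cu F.cuv F.κ / F.a := by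
        field_simp

/-! ### D.8 The bound (1.89) at the fiber `p′ ≠ 0` -/

/-- **B5 (1.89), fiber form, `p′ ≠ 0`.**  For admissible weights (`Fiber.Wt`; in particular
for products of lattice-derivative symbols of total order ≤ 2, `Wt_of_orders`) the weighted
fiber matrix `D_{w₁} G(p′) D_{w₂}^*` of (1.83) has `ℓ² → ℓ²` norm at most
`gamma0inv d a c_u c_uv κ` — a constant depending on `d`, `a` and the three leaf constants
only (independent of `p′`, of `k` and of the torus). [B5 p.32: "we can easily prove that this
expression defines a bounded operator on L²(T_η). It is bounded also when differentiated two
times at most." — no proof printed; this is ours.]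
[cite: Balaban1984PropagatorsI, Prop. 1.1 (1.89) p.33 (fiber form; no proof printed — proof ours)] -/
theorem opNorm_sandwich_G_le {w₁ w₂ : Λ → ℂ} (hw : F.Wt w₁ w₂) :
    ‖sandwich w₁ w₂ F.G‖ ≤ gamma0inv d F.a F.cu F.cuv F.κ := by
  rw [sandwich_G_eq]
  refine (norm_add₅_le _ _ _ _ _).trans ?_
  have h1 : ‖Matrix.diagonal (F.dg w₁ w₂)‖ ≤ K00 F.a F.cuv :=
    opNorm_diagonal_le F.K00_nonneg (F.norm_dg_le hw)
  have h2 := F.piece_R_le hw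
  have h3 := F.piece_C1_le hw
  have h4 := F.piece_C2_le hw
  have h5 := F.piece_T_le hw
  rw [gamma0inv]
  linarith

/-- (1.89), `‖GJ‖`: the unweighted fiber matrix.
[cite: Balaban1984PropagatorsI, Prop. 1.1 (1.89) p.33 (fiber form; proof ours)] -/
theorem opNorm_G_le : ‖F.G‖ ≤ gamma0inv d F.a F.cu F.cuv F.κ := by
  have h := F.opNorm_sandwich_G_le F.Wt_one
  rwa [sandwich_one] at h

/-- (1.89), `‖∇GJ‖, ‖G∇*J‖, ‖∇G∇*J‖, ‖∇∇GJ‖, ‖G∇*∇*J‖` at the fiber: weights of derivative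
orders `j₁` (left) and `j₂` (right) with `j₁ + j₂ ≤ 2`.
[cite: Balaban1984PropagatorsI, Prop. 1.1 (1.89) p.33 (fiber form; proof ours)] -/
theorem opNorm_sandwich_G_le_of_orders {w₁ w₂ : Λ → ℂ} {j₁ j₂ : ℕ} (hj : j₁ + j₂ ≤ 2)
    (h₁ : ∀ l, ‖w₁ l‖ ^ 2 ≤ F.Δ l ^ j₁) (h₂ : ∀ l, ‖w₂ l‖ ^ 2 ≤ F.Δ l ^ j₂) :
    ‖sandwich w₁ w₂ F.G‖ ≤ gamma0inv d F.a F.cu F.cuv F.κ :=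
  F.opNorm_sandwich_G_le (F.Wt_of_orders hj h₁ h₂)

/-! ### D.9 Symmetry -/

/-- `a⁻¹ Φ⁻¹` is real. [folklore] -/
lemma conj_cT : conj F.cT = F.cT := by
  simp only [cT, map_div₀, map_one, map_mul, Complex.conj_ofReal]

/-- "The operator G is a symmetric operator": each fiber matrix of (1.83) is Hermitian.
[cite: Balaban1984PropagatorsI, Prop. 1.1 p.33 ("G is a symmetric operator"; fiber form, proof ours)] -/
theorem G_isHermitian : F.G.IsHermitian := by
  refine Matrix.IsHermitian.ext fun i j => ?_
  obtain ⟨l, μ⟩ := i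
  obtain ⟨l', ν⟩ := j
  by_cases hμ : μ = ν
  · subst hμ
    by_cases hl : l = l'
    · subst hl
      simp only [G, if_true, Complex.star_def, map_add, map_sub, map_mul,
        map_div₀, map_one, Complex.conj_conj, Complex.conj_ofReal, conj_cT]
      ring
    · simp only [G, if_true, hl, Ne.symm hl, if_false, Complex.star_def, map_add,
        map_sub, map_mul, map_div₀, map_zero, Complex.conj_conj, Complex.conj_ofReal, conj_cT]
      ring
  · simp only [G, hμ, Ne.symm hμ, if_false, Complex.star_def, map_add, map_mul, map_zero,
      Complex.conj_conj, conj_cT]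
    ring

end Fiber

/-! ## E. The fiber `p′ = 0` -/

section ZeroFiber

variable {Λ : Type*} [Fintype Λ] [DecidableEq Λ] {d : ℕ}

/-- (1.83), second and third equalities: at `p′ = 0`, `Ã_μ(l) = J̃_μ(l)/Δ(l)` for `l ≠ 0` and
`Ã_μ(0) = a⁻¹ J̃_μ(0)`: the diagonal matrix `diag(a⁻¹ at l = 0, Δ(l)⁻¹ else)`.
[cite: Balaban1984PropagatorsI, (1.83) p.31] -/
def G₀ (o : Λ) (a : ℝ) (Δ : Λ → ℝ) : Matrix (Λ × Fin d) (Λ × Fin d) ℂ :=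
  Matrix.diagonal fun i => if i.1 = o then 1 / (a : ℂ) else 1 / (Δ i.1 : ℂ)

/-- The fiber `p′ = 0` with weights: `|w₁(0) w₂(0)| ≤ 1` (at `p′ = 0` all derivative symbols of
positive order vanish at `l = 0`) and `|w₁(l) w₂(l)| ≤ Δ(l)` for `l ≠ 0` give the bound
`max(a⁻¹, 1)`. [cite: Balaban1984PropagatorsI, (1.83) p.31 (fiber p′ = 0; proof ours)] -/
theorem opNorm_sandwich_G₀_le (o : Λ) {a : ℝ} (ha : 0 < a) (Δ : Λ → ℝ)
    (hΔ : ∀ l, l ≠ o → 0 < Δ l) (w₁ w₂ : Λ → ℂ) (hwo : ‖w₁ o‖ * ‖w₂ o‖ ≤ 1)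
    (hwl : ∀ l, l ≠ o → ‖w₁ l‖ * ‖w₂ l‖ ≤ Δ l) :
    ‖sandwich w₁ w₂ (G₀ (d := d) o a Δ)‖ ≤ max (1 / a) 1 := by
  have hsw : sandwich w₁ w₂ (G₀ (d := d) o a Δ) = Matrix.diagonal fun i : Λ × Fin d =>
      w₁ i.1 * (if i.1 = o then 1 / (a : ℂ) else 1 / (Δ i.1 : ℂ)) * conj (w₂ i.1) := by
    ext i j
    simp only [sandwich, G₀, Matrix.diagonal_apply]
    by_cases hij : i = j
    · subst hij
      simp only [if_true]
    · simp only [hij, if_false, mul_zero, zero_mul]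
  rw [hsw]
  refine opNorm_diagonal_le (le_trans zero_le_one (le_max_right _ _)) fun i => ?_
  obtain ⟨l, μ⟩ := i
  by_cases hl : l = o
  · subst hl
    simp only [if_true]
    rw [norm_mul, norm_mul, Complex.norm_conj, norm_div, norm_one, Complex.norm_of_nonneg ha.le]
    calc ‖w₁ l‖ * (1 / a) * ‖w₂ l‖ = ‖w₁ l‖ * ‖w₂ l‖ * (1 / a) := by ring
      _ ≤ 1 * (1 / a) := mul_le_mul_of_nonneg_right hwo (div_nonneg zero_le_one ha.le)
      _ ≤ max (1 / a) 1 := by rw [one_mul]; exact le_max_left _ _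
  · simp only [hl, if_false]
    rw [norm_mul, norm_mul, Complex.norm_conj, norm_div, norm_one,
      Complex.norm_of_nonneg (hΔ l hl).le]
    calc ‖w₁ l‖ * (1 / Δ l) * ‖w₂ l‖ = ‖w₁ l‖ * ‖w₂ l‖ / Δ l := by ring
      _ ≤ 1 := (div_le_one (hΔ l hl)).mpr (hwl l hl)
      _ ≤ max (1 / a) 1 := le_max_right _ _

end ZeroFiber

end

end Literature.MathematicalPhysics.QuantumFieldTheory.Balaban1983to89.B5Prop11Bound
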